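import Literature.MathematicalPhysics.QuantumFieldTheory.Balaban1983to89.T4CouplingAnalyticity

/-!
# T4CouplingAnalyticityWitness — node U3's typed reduction «NE9 ∧ FadingMemory ⇐ StepTransfer ⇐ analytic dilation step»
(`T4CouplingAnalyticity` §§5–7, §14) IS SHARP, NON-VACUOUS AND NON-DEGENERATE: the rate `μ = ω₀ + a` of
`ne9_and_fadingMemory_of_stepTransfer` is ATTAINED on the class (so the smallness (W4) `ω₀ + a < 1` is NECESSARY for the
class, not a proof artefact), and explicit, genuinely coupling-dependent, genuinely HOLOMORPHIC toy families discharge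
every binder of `ne9T_of_dilationStep` and of the weighted variable-window theorem `ne9T_of_dilationStepV` BY NAME, with
finite nonzero constants and — for the latter — an UNBOUNDED window profile (cell `pub-balaban`, T4-DAG v20 §2 node U3 /
§6 NE9; journal row T4-U3.E-NE9-PROVE-P1g*; a WITNESS and a SHARPNESS statement about the lineage's OWN typed shapes,
NO estimate of the cell's NEW-ESTIMATE kind, NOT an instance of Bałaban's activities, NOT summit progress).

HONEST FRAMING (T4-DAG PAGE 1).  The cell's T4 target is rung (B)+1: existence AND uniqueness of the ε → 0 limit of
Bałaban's unit-scale averaged expectations on a FIXED finite torus — strictly beyond ultraviolet stability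
([Balaban1988Convergent] Cor. 3 p. 264; [Balaban1989LargeFieldII] Thm 1 p. 355), and NOT infinite volume, NOT a mass gap,
NOT the Clay problem; the hypotheses BetaPertH, (B), (B^μ) of the cell's chain stay explicit and are untouched here.  This
module ASSERTS NOTHING about Bałaban's functionals.  It answers TWO bookkeeping questions about the lineage module
`T4CouplingAnalyticity` (v1.6): (a) is the smallness condition (W4) of the full-history renewal shape `StepTransfer`
(`NE9 ∧ FadingMemory` at rate `ω₀ + a`) an artefact of the proof, or a property of the CLASS? — answer (kernel, §1): of the
class: the rate is attained by a member, so no NE9-table of that member has fading memory below `ω₀ + a`, and for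
`1 ≤ ω₀ + a` none at any rate `< 1`; (b) are the binder lists of the analytic step theorems `ne9T_of_dilationStep`
((AN-LAST-dil), (AN-OLD), (CONTR), evaluation, coupling-free scale 0) and `ne9T_of_dilationStepV` (+ window independence,
WEIGHTED per-slot bounds `M₁ j`, absorption `4M₁ j/(c·t₀) ≤ σ₀·ν^{N j}`, `ν < μ ≤ 1`) JOINTLY SATISFIABLE BY DATA ON WHICH THE
CONCLUSION HAS CONTENT (a functional that depends on every earlier coupling through a genuine pole, every NE9-table forced
strictly positive, a window profile that is unbounded)? — answer (kernel, §§2–3): YES.  The cross-read of v1.6 (pv11-g15)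
remarked that the in-module inhabitation lemma `shapes_nonvacuous₅` uses zero functionals; §2–§3 replace it by
non-degenerate witnesses.  ABSOLUTE RULE of the cell honoured: no internally-minted statement enters as a cited fact; the
toys are DEFINED here and everything about them is PROVED here; the manuscripts under audit are named for STRUCTURE only.

## What is typed and proved (all [folklore]: elementary real/complex analysis on explicit toys)

§1 (activities in `ℝ`) THE LINEAR RENEWAL TOY `linToy ℓ a ω₀` (`V 0 = 0`, `V (j+1) g = ℓ·g_j + a·A_j g`, aggregate
   `A_{j+1} = (ω₀ + a)·A_j + ℓ·g_j`, `linAgg_eq_sum`: `A_j = Σ_{m≤j} ω₀^{j−m} V_m`): `stepTransfer_linToy` (it IS a member of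
   `StepTransfer (linToy ℓ a ω₀) W ℓ a ω₀` on every window, `ℓ, a, ω₀ ≥ 0`); exact response to a bump of ONE coupling
   (`linAgg_bump`, `linToy_bump_last`, `linToy_bump_old`: `V_{i+2+n}` moves by `a·ℓ·(ω₀+a)^n·δ`); hence
   `moduli_lower_of_normNE9` (every table `Λ` with `NormNE9` has `ℓ ≤ Λ (i+1) i` and `a·ℓ·(ω₀+a)^n ≤ Λ (i+2+n) i` as soon as the
   window contains a bump at slot `i`), `rate_le_of_fadingMemory` (**SHARPNESS**: `NormNE9 Λ ∧ FadingMemory C₉ ω Λ ⇒ ω₀ + a ≤ ω`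
   for `ℓ, a > 0`), `not_fadingMemory_of_one_le`, `stepTransfer_rate_sharp` (∃ a scale-0-free member of the class whose
   NE9-tables all have rate `≥ ω₀ + a`, while `geomMod` at rate `ω₀ + a` IS a table: the bound of
   `ne9_and_fadingMemory_of_stepTransfer` is attained); on the trivial carriers `natCarriers` (domain = scale, `d ≡ 0`) the
   `T4OutputRate.NE9` form: `ne9_linFunc`, `normNE9_of_ne9_linFunc`, `ne9_rate_sharp`, and the **SMALLNESS DICHOTOMY**
   `smallness_dichotomy`: (i) `ω₀ + a < 1` ⇒ EVERY real activity family on `natCarriers` that is coupling-free at scale 0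
   and `StepTransfer (…) ℓ a ω₀` over a box window has `NE9 ∧ FadingMemory` at a rate `< 1`; (ii) `1 ≤ ω₀ + a` ⇒ the member
   `linToy` has, for EVERY NE9-table, NO fading memory at ANY rate `< 1`.
   So (W4) is NECESSARY on the class.  (The sibling seat P2's `T4HistoryLipschitzRecursion.sticky_not_fadingMemory` is a
   different no-go — a non-contracting one-step transport; it is named here for orientation only and NOT imported.)
§2 (activities in `ℂ`) THE ANALYTIC DILATION TOY `DilData` (parameters `t₀ > 0`, `0 < c < 1`, `α > 0`, `β ≥ 0`, `0 ≤ θ ≤ 1`,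
   `ω₀ ≥ 0`, `ω₀ + β·θ < 1`): step map `Φ(z, w) = α·t₀/z + β·w` — a GENUINE POLE AT THE VERTEX `z = 0`, holomorphic on the
   dilation domain `lastDom = {‖z‖ ≥ (1−c)·t₀}` which contains every relative disc `|z − s| ≤ c·s`, `s ≥ t₀`
   (`closedBall_subset_lastDom`) — activities `act (j+1) g = Φ(g_j, θ·agg_j g)`, aggregate `agg_{j+1} = ω₀·agg_j + act_{j+1}`
   (`agg_eq_sum`), transported data `trans = θ·agg` with (CONTR) (`trans_contracts`, via `contracts_of_sum`); a-priori radius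
   `B = α/(1 − ω₀ − βθ)` (`norm_agg_le`, discrete Grönwall), `B_T = θ·B`; (AN-LAST-dil) with `M₁ = α/(1−c) + β·B_T`
   (`an_last_core`, `an_last`), (AN-OLD) with `M₂(ϱ) = α + β·(B_T + ϱ)` on `‖w‖ ≤ B_T + ϱ` (`an_old_core`, `an_old`); the
   functional `func C Bg κ g U X = e^{−κ·d X}·Re act_{scale X} g` on ANY carriers, evaluation Lipschitz (`ev_lipschitz`);
   **`ne9T_witness` = `ne9T_of_dilationStep` APPLIED BY NAME**: `NE9 (func …) (BoxWindow (Ici t₀)) κ (geomMod ℓ μ) ∧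
   FadingMemory (ℓ/μ) μ (geomMod ℓ μ)` with `ℓ = 4M₁/(c·t₀)`, `μ = ω₀ + 4M₂(ϱ)/ϱ`.  NON-DEGENERACY (real shadow `actR`/`aggR`,
   `func_eq`): `bump_lt`/`func_bump_lt` (raising ONE earlier coupling STRICTLY lowers every later activity, `β, θ > 0`), hence
   `moduli_pos_of_ne9` (EVERY table `Λ` with `NE9 (func …) … Λ` has `0 < Λ (scale X) i` for all `i < scale X`: the witness is
   not a zero functional and not last-coupling-only); the printed-form side conditions also hold: `func_prefix`
   (`PrefixDependenceOn`), `func_decayBound` (`DecayBound … B κ`, the (1.18)-form).  NUMBERS `P₀` (`t₀ = 1`, `c = 1/2`,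
   `α = β = 1/16`, `θ = 1`, `ω₀ = 1/4`; `B = B_T = 1/11`, `M₁ = M₂(1) = 23/176`): `P₀_rate` (`μ = 17/22`), `P₀_ell` (`ℓ = 23/22`),
   `P₀_small`, and `witness_summary` (∃ E Λ C₉ ω E₀: PrefixDependenceOn ∧ DecayBound ∧ NE9 ∧ FadingMemory ∧ ω < 1 ∧ every
   NE9-table of E strictly positive).
§3 (activities in `ℂ`) THE WEIGHTED VARIABLE-WINDOW TOY `WinData` (= `DilData` + weight base `0 ≤ ν ≤ 1` + an ARBITRARY window
   profile `N : ℕ → ℕ`): window step map `Φ_j(H, w) = ν^{N j}·Φ(H_{j − N j}, w)` — the newborn window-activity reads the OLDEST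
   coupling of its window (worst case for memory) and carries the weight `ν^{N j}` AS A WHOLE (the typed form of [H-dil-N] WITH
   the weight, `T4CouplingAnalyticity` §14) —; `win` (dependence only through the window slots), `aggV_eq_sum`,
   `transV_contracts`, `norm_aggV_le` (same radius `B`), `an_lastV` (per-slot weighted (AN-WIN-dil): bound `ν^{N j}·M₁`; exact
   constancy off the oldest slot), `an_oldV`; **`ne9T_witnessV` = `ne9T_of_dilationStepV` APPLIED BY NAME** for every `ϱ > 0`
   with `ν < μ ≤ 1`: `NE9 (funcV …) (BoxWindow (Ici t₀)) κ (srcMod (vwinSrc (j ↦ 4ν^{N j}M₁/(c·t₀)) N) μ) ∧ FadingMemory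
   (σ₀/(μ − ν)) μ (…)`, `σ₀ = 4M₁/(c·t₀)` (absorption at EQUALITY) — UNIFORM-IN-SCALE moduli although `N` is unbounded.  INSTANCE
   `Q₀` (`P₀` + `ν = 1/2`, `N j = ⌊j/2⌋`): `Q₀_window_unbounded`, `Q₀_fires` (rate `17/22`).
§4 (v1.1; activities in `ℂ`, real shadow) THE WEIGHT IS NECESSARY: real shadow `stepMapVR`/`aggVR`/`actVR`/`funcV_eq`; the window
   toy is ANTITONE in the history (`antitone_hist`); doubling the OLDEST window slot lowers the newborn activity by
   `≥ ν^{N j}·α/2` (`actVR_drop`); hence EVERY NE9-table on the toy carriers remembers that slot: `ν^{N j}·α/(2t₀) ≤ Λ (j+1)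
   (j − N j)` (`weight_le_moduli`); **`rate_floor`**: if the profile is unbounded along scales with `N j ≤ j` and `ν > 0`, every
   NE9-table with `FadingMemory C₉ ω`, `ω ≥ 0`, has `ν ≤ ω` — the hypothesis `ν < μ` of `ne9T_of_dilationStepV` /
   `fadingMemory_vwinSrc` cannot be weakened below `ν ≤ μ`, the true rate is BRACKETED in `[ν, μ]` (`rate_bracket`,
   `Q₀_rate_floor`: `[1/2, 17/22]` for `Q₀`); **`not_fadingMemory_unweighted`** / instance **`Q₁_no_fading`** (`ν = 1`,
   `N j = ⌊j/2⌋`): an UNWEIGHTED unbounded window admits NO NE9-table with fading memory at ANY rate `0 ≤ ω < 1`, for any `C₉` —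
   the kernel form of why «(WIN) N fixed» was withdrawn (record §13.2) and why [H-dil-N] must carry the printed WEIGHT.
WHAT THIS SHOWS AND WHAT IT DOES NOT.  Shows: the lineage's reduction is internally consistent and not secretly degenerate
(no hidden quantifier/ordering/junk-value defect makes the analytic binders force a coupling-free or zero functional; the
constants compose; the weighted window bookkeeping of §14 absorbs an unbounded profile), its smallness hypothesis is
TIGHT on the class, and the WEIGHT in [H-dil-N] is load-bearing (no weight ⇒ no uniform fading memory on the class).  Does NOT show: [H-dil] / [H-dil-N] for Bałaban's 𝐑-operation — the dilation-disc analyticity of the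
(2.13)/(2.14) activities in the last coupling with the printed weight is NOT PRINTED (record `t4/T4-EST-NE9-P1.md` §3, §13;
GAPS G-ne9p1-1 … 12) —, nor NE9 for them (cell NEW ESTIMATE, node U3).  The wall of node U3 on this route is unchanged and
typed: the binder `hlast` of `T4CouplingAnalyticity.stepTransferV_of_analyticOn` for Bałaban's step with
`M₁ j = M·exp(−A₀ (log t_j)^{p₀})`.

CITATION HEADER (lean-in-tree rule 2026-08-18).  NO passage of any source is quoted in this module; every declaration is
[folklore] (defined and proved here).  The bracketed keys above name the manuscripts for FRAMING/STRUCTURE only: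
T. Bałaban, *Renormalization group approach to lattice gauge field theories. I.*, Commun. Math. Phys. **109**, 249–301 (1987)
[Balaban1987RG1] (B12; (1.18) p. 263, (2.13)/(2.14) p. 268 — shapes only); *II.*, Commun. Math. Phys. **116**, 1–22 (1988)
[Balaban1988RG2Cluster] (B13); *Convergent renormalization expansions for lattice gauge theories*, Commun. Math. Phys. **119**,
243–285 (1988) [Balaban1988Convergent] (B14); *Large field renormalization. II*, Commun. Math. Phys. **122**, 355–392 (1989)
[Balaban1989LargeFieldII] (B16).  The Bałaban papers are manuscripts UNDER ADJUDICATION by the audit cell `pub-balaban`: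
NOTHING printed in them is asserted here.  Kernel inputs imported BY NAME: `T4CouplingAnalyticity` v1.6 (this lineage,
p187391: `StepTransfer`, `NormNE9`, `ne9_and_fadingMemory_of_stepTransfer`, `normNE9_of_stepTransfer`, `fadingMemory_geomMod`,
`contracts_of_sum`, `geomMod`, `BoxWindow`, `update_mem_boxWindow`, `ne9T_of_dilationStep`, `srcMod`, `vwinSrc`,
`ne9T_of_dilationStepV`) and through it
`T4OutputRate` (pv05: `Carriers`, `Functional`, `NE9`, `FadingMemory`, `PrefixDependenceOn`, `DecayBound`) and Mathlib; it
modifies nothing.  NEW LEAF of unit `b2b-balaban-t4-ne9-p1-g7` (NE9 prover P1, analytic-dependence route, generation 7;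
journal ONLINE + CLAIM T4-U3.E-NE9-PROVE-P1g*); v1 p188129 (§§1–3); v1.1 p188302 (same seat, APPEND-ONLY: + §4, no v1
declaration changed); v1.2 (same seat, HEADER-ONLY: DOCFIX D-1/D-2 of the cross-read C-pv11g15-8 — clause (i) of the §1
summary and the by-name input list —; no declaration touched); v1.3 (generation 8 of the lineage, journal claim
T4-U3.E-NE9-PROVE-P1h*, DOCSTRING-ONLY: the locator of (2.13)/(2.14) of [Balaban1987RG1] in this header corrected from p. 266 to
p. 268 — render `1987-cmp109-rg-I-small-field-p020-x2.png` re-read as an image; ref2 pass 13, GAPS-T4 G-t4r2-22 — and the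
parenthesis on `0 ≤ ω` in the docstring of `WinData.rate_floor` reworded — cross-read C-pv11g15-9, item D-3 —; no declaration,
statement or proof touched).
-/

noncomputable section

open Complex Metric Set
open scoped BigOperators
open Literature.MathematicalPhysics.QuantumFieldTheory.Balaban1983to89.T4OutputRate
open Literature.MathematicalPhysics.QuantumFieldTheory.Balaban1983to89.T4CouplingAnalyticity

namespace Literature.MathematicalPhysics.QuantumFieldTheory.Balaban1983to89.T4CouplingAnalyticityWitness

/-! ## §1  The linear renewal toy: `StepTransfer` is saturated and its rate `μ = ω₀ + a` is SHARP -/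

/-- The transported aggregate of the linear toy: `A 0 = 0`, `A (j+1) = (ω₀ + a)·A j + ℓ·g_j`. [folklore] -/
def linAgg (ℓ a ω₀ : ℝ) : ℕ → (ℕ → ℝ) → ℝ
  | 0, _ => 0
  | j + 1, g => (ω₀ + a) * linAgg ℓ a ω₀ j g + ℓ * g j

/-- The linear renewal toy (activities in `ℝ`): `V 0 = 0`, `V (j+1) g = ℓ·g_j + a·A j g` with `A j g = Σ_{m≤j} ω₀^{j−m} V m g`
(`linAgg_eq_sum`). [folklore] -/
def linToy (ℓ a ω₀ : ℝ) : ℕ → (ℕ → ℝ) → ℝ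
  | 0, _ => 0
  | j + 1, g => ℓ * g j + a * linAgg ℓ a ω₀ j g

/-- Scale-0 value of the linear aggregate. [folklore] -/
@[simp] theorem linAgg_zero (ℓ a ω₀ : ℝ) (g : ℕ → ℝ) : linAgg ℓ a ω₀ 0 g = 0 := rfl

/-- Recursion of the linear aggregate. [folklore] -/
theorem linAgg_succ (ℓ a ω₀ : ℝ) (j : ℕ) (g : ℕ → ℝ) :
    linAgg ℓ a ω₀ (j + 1) g = (ω₀ + a) * linAgg ℓ a ω₀ j g + ℓ * g j := rfl

/-- Scale-0 value of the linear toy (coupling-free). [folklore] -/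
@[simp] theorem linToy_zero (ℓ a ω₀ : ℝ) (g : ℕ → ℝ) : linToy ℓ a ω₀ 0 g = 0 := rfl

/-- Recursion of the linear toy. [folklore] -/
theorem linToy_succ (ℓ a ω₀ : ℝ) (j : ℕ) (g : ℕ → ℝ) :
    linToy ℓ a ω₀ (j + 1) g = ℓ * g j + a * linAgg ℓ a ω₀ j g := rfl

/-- The aggregate IS the ω₀-damped sum of the activities: `A j g = Σ_{m≤j} ω₀^{j−m}·V m g`. [folklore] -/
theorem linAgg_eq_sum (ℓ a ω₀ : ℝ) (j : ℕ) (g : ℕ → ℝ) :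
    linAgg ℓ a ω₀ j g = ∑ m ∈ Finset.range (j + 1), ω₀ ^ (j - m) * linToy ℓ a ω₀ m g := by
  induction j with
  | zero => simp
  | succ j ih =>
    rw [Finset.sum_range_succ, Nat.sub_self, pow_zero, one_mul, linAgg_succ, linToy_succ]
    have hsum : ∑ m ∈ Finset.range (j + 1), ω₀ ^ (j + 1 - m) * linToy ℓ a ω₀ m g =
        ω₀ * ∑ m ∈ Finset.range (j + 1), ω₀ ^ (j - m) * linToy ℓ a ω₀ m g := by
      rw [Finset.mul_sum]
      refine Finset.sum_congr rfl fun m hm => ?_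
      rw [Finset.mem_range] at hm
      rw [show j + 1 - m = (j - m) + 1 by omega, pow_succ]
      ring
    rw [hsum, ← ih]
    ring

/-- **The linear toy satisfies `StepTransfer` with the SAME constants** (`ℓ, a, ω₀ ≥ 0`), over every window. [folklore] -/
theorem stepTransfer_linToy {ℓ a ω₀ : ℝ} (hℓ : 0 ≤ ℓ) (ha : 0 ≤ a) (hω : 0 ≤ ω₀) (W : Set (ℕ → ℝ)) :
    StepTransfer (linToy ℓ a ω₀) W ℓ a ω₀ := by
  intro j g _ g' _
  rw [linToy_succ, linToy_succ, Real.norm_eq_abs]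
  have hA : |linAgg ℓ a ω₀ j g - linAgg ℓ a ω₀ j g'| ≤
      ∑ m ∈ Finset.range (j + 1), ω₀ ^ (j - m) * ‖linToy ℓ a ω₀ m g - linToy ℓ a ω₀ m g'‖ := by
    rw [linAgg_eq_sum, linAgg_eq_sum, ← Finset.sum_sub_distrib]
    refine (Finset.abs_sum_le_sum_abs _ _).trans (Finset.sum_le_sum fun m _ => ?_)
    rw [← mul_sub, abs_mul, abs_of_nonneg (pow_nonneg hω _), Real.norm_eq_abs]
  calc |ℓ * g j + a * linAgg ℓ a ω₀ j g - (ℓ * g' j + a * linAgg ℓ a ω₀ j g')|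
      = |ℓ * (g j - g' j) + a * (linAgg ℓ a ω₀ j g - linAgg ℓ a ω₀ j g')| := by ring_nf
    _ ≤ |ℓ * (g j - g' j)| + |a * (linAgg ℓ a ω₀ j g - linAgg ℓ a ω₀ j g')| := abs_add_le _ _
    _ = ℓ * |g j - g' j| + a * |linAgg ℓ a ω₀ j g - linAgg ℓ a ω₀ j g'| := by
        rw [abs_mul, abs_mul, abs_of_nonneg hℓ, abs_of_nonneg ha]
    _ ≤ ℓ * |g j - g' j| + a * ∑ m ∈ Finset.range (j + 1), ω₀ ^ (j - m) * ‖linToy ℓ a ω₀ m g - linToy ℓ a ω₀ m g'‖ :=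
        add_le_add le_rfl (mul_le_mul_of_nonneg_left hA ha)

/-- The aggregate at scale `j ≤ i` does not see the coupling `g_i` (prefix dependence). [folklore] -/
theorem linAgg_update_of_le (ℓ a ω₀ : ℝ) {j i : ℕ} (hji : j ≤ i) (g : ℕ → ℝ) (v : ℝ) :
    linAgg ℓ a ω₀ j (Function.update g i v) = linAgg ℓ a ω₀ j g := by
  induction j with
  | zero => rfl
  | succ j ih =>
    rw [linAgg_succ, linAgg_succ, ih (by omega), Function.update_of_ne (by omega)]

/-- RESPONSE OF THE AGGREGATE to a bump `δ` of the coupling `g_i`, `n + 1` scales later: exactly `ℓ·μ^n·δ`, `μ = ω₀ + a`.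
[folklore] -/
theorem linAgg_bump (ℓ a ω₀ : ℝ) (i n : ℕ) (g : ℕ → ℝ) (δ : ℝ) :
    linAgg ℓ a ω₀ (i + 1 + n) (Function.update g i (g i + δ)) - linAgg ℓ a ω₀ (i + 1 + n) g =
      ℓ * (ω₀ + a) ^ n * δ := by
  induction n with
  | zero =>
    rw [Nat.add_zero, linAgg_succ, linAgg_succ, linAgg_update_of_le ℓ a ω₀ le_rfl, Function.update_self]
    ring
  | succ n ih =>
    rw [show i + 1 + (n + 1) = (i + 1 + n) + 1 by omega, linAgg_succ, linAgg_succ,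
      Function.update_of_ne (by omega)]
    have := ih
    rw [pow_succ]
    linear_combination (ω₀ + a) * this

/-- RESPONSE OF THE NEWBORN ACTIVITY to a bump of the LAST coupling: exactly `ℓ·δ`. [folklore] -/
theorem linToy_bump_last (ℓ a ω₀ : ℝ) (i : ℕ) (g : ℕ → ℝ) (δ : ℝ) :
    linToy ℓ a ω₀ (i + 1) (Function.update g i (g i + δ)) - linToy ℓ a ω₀ (i + 1) g = ℓ * δ := by
  rw [linToy_succ, linToy_succ, linAgg_update_of_le ℓ a ω₀ le_rfl, Function.update_self]
  ring

/-- RESPONSE OF THE NEWBORN ACTIVITY to a bump of an OLD coupling `g_i`, `n + 2` scales later: exactly `a·ℓ·μ^n·δ`. [folklore] -/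
theorem linToy_bump_old (ℓ a ω₀ : ℝ) (i n : ℕ) (g : ℕ → ℝ) (δ : ℝ) :
    linToy ℓ a ω₀ (i + 2 + n) (Function.update g i (g i + δ)) - linToy ℓ a ω₀ (i + 2 + n) g =
      a * ℓ * (ω₀ + a) ^ n * δ := by
  rw [show i + 2 + n = (i + 1 + n) + 1 by omega, linToy_succ, linToy_succ, Function.update_of_ne (by omega)]
  have := linAgg_bump ℓ a ω₀ i n g δ
  linear_combination a * this

/-- The history sum of a moduli table against a one-slot bump collapses to the bumped slot. [folklore] -/
theorem sum_moduli_bump (Λ : ℕ → ℕ → ℝ) {j i : ℕ} (hij : i < j) (g : ℕ → ℝ) (δ : ℝ) :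
    ∑ i' ∈ Finset.range j, Λ j i' * |Function.update g i (g i + δ) i' - g i'| = Λ j i * |δ| := by
  rw [Finset.sum_eq_single i (fun i' _ hi' => by rw [Function.update_of_ne hi', sub_self, abs_zero, mul_zero])
    (fun h => absurd (Finset.mem_range.2 hij) h)]
  rw [Function.update_self, add_sub_cancel_left]

/-- **LOWER BOUNDS ON ANY MODULI TABLE of the linear toy**: if `NormNE9 (linToy ℓ a ω₀) W Λ` and the window admits a bump
`g, g[i := g_i + δ] ∈ W` with `δ > 0`, then `Λ (i+1) i ≥ ℓ` and `Λ (i+2+n) i ≥ a·ℓ·μ^n` for every `n`: the geometric moduli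
`geomMod ℓ μ` of `normNE9_of_stepTransfer` are attained up to the factor `a/μ ≤ 1` on the old slots. [folklore] -/
theorem moduli_lower_of_normNE9 {ℓ a ω₀ : ℝ} {W : Set (ℕ → ℝ)} {Λ : ℕ → ℕ → ℝ}
    (hΛ : NormNE9 (linToy ℓ a ω₀) W Λ) {g : ℕ → ℝ} {i : ℕ} {δ : ℝ} (hδ : 0 < δ) (hg : g ∈ W)
    (hg' : Function.update g i (g i + δ) ∈ W) :
    ℓ ≤ Λ (i + 1) i ∧ ∀ n, a * ℓ * (ω₀ + a) ^ n ≤ Λ (i + 2 + n) i := by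
  constructor
  · have h := hΛ (i + 1) _ hg' _ hg
    rw [sum_moduli_bump Λ (by omega), Real.norm_eq_abs, linToy_bump_last, abs_of_pos hδ] at h
    have h' : ℓ * δ ≤ Λ (i + 1) i * δ := (le_abs_self _).trans h
    exact le_of_mul_le_mul_right h' hδ
  · intro n
    have h := hΛ (i + 2 + n) _ hg' _ hg
    rw [sum_moduli_bump Λ (by omega), Real.norm_eq_abs, linToy_bump_old, abs_of_pos hδ] at h
    have h' : a * ℓ * (ω₀ + a) ^ n * δ ≤ Λ (i + 2 + n) i * δ := (le_abs_self _).trans h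
    exact le_of_mul_le_mul_right h' hδ

/-- **THE RATE IS SHARP**: for `ℓ, a > 0` ANY fading-memory bound `Λ j i ≤ C₉ω^{j−i}` on ANY moduli table of the linear toy
has rate `ω ≥ μ = ω₀ + a` (window admitting one bump at some slot). [folklore] -/
theorem rate_le_of_fadingMemory {ℓ a ω₀ : ℝ} (hℓ : 0 < ℓ) (ha : 0 < a) (hω : 0 ≤ ω₀) {W : Set (ℕ → ℝ)}
    {Λ : ℕ → ℕ → ℝ} (hΛ : NormNE9 (linToy ℓ a ω₀) W Λ) {g : ℕ → ℝ} {i : ℕ} {δ : ℝ} (hδ : 0 < δ) (hg : g ∈ W)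
    (hg' : Function.update g i (g i + δ) ∈ W) {C₉ ω : ℝ} (hF : FadingMemory C₉ ω Λ) : ω₀ + a ≤ ω := by
  obtain ⟨h1, h2⟩ := moduli_lower_of_normNE9 hΛ hδ hg hg'
  have hμ : 0 < ω₀ + a := by linarith
  -- signs of C₉ and ω from the two first lower bounds
  have hC1 : ℓ ≤ C₉ * ω := by
    have := (hF (i + 1) i (by omega)).2
    rw [show i + 1 - i = 1 by omega, pow_one] at this
    exact h1.trans this
  have hC2 : a * ℓ ≤ C₉ * ω ^ 2 := by
    have := (hF (i + 2 + 0) i (by omega)).2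
    rw [show i + 2 + 0 - i = 2 by omega] at this
    have h20 := h2 0
    rw [pow_zero, mul_one] at h20
    exact h20.trans this
  have hCω : 0 < C₉ * ω := lt_of_lt_of_le hℓ hC1
  have hω0 : ω ≠ 0 := by
    rintro rfl
    simp at hCω
  have hC : 0 < C₉ := by
    by_contra hC
    push Not at hC
    have : C₉ * ω ^ 2 ≤ 0 := mul_nonpos_of_nonpos_of_nonneg hC (sq_nonneg ω)
    nlinarith [mul_pos ha hℓ]
  have hωpos : 0 < ω := by
    rcases pos_and_pos_or_neg_and_neg_of_mul_pos hCω with h | h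
    · exact h.2
    · exact absurd h.1 (not_lt.2 hC.le)
  by_contra hlt
  push Not at hlt
  -- q := ω/μ < 1 and a·ℓ/(C₉ω²) ≤ q^n for every n: contradiction
  set q : ℝ := ω / (ω₀ + a) with hq
  have hq0 : 0 < q := div_pos hωpos hμ
  have hq1 : q < 1 := (div_lt_one hμ).2 hlt
  have hK : 0 < a * ℓ / (C₉ * ω ^ 2) := div_pos (mul_pos ha hℓ) (by positivity)
  obtain ⟨n, hn⟩ := exists_pow_lt_of_lt_one hK hq1
  have hn' := h2 n
  have hFn := (hF (i + 2 + n) i (by omega)).2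
  rw [show i + 2 + n - i = n + 2 by omega] at hFn
  have key : a * ℓ * (ω₀ + a) ^ n ≤ C₉ * ω ^ (n + 2) := hn'.trans hFn
  -- divide: a ℓ/(C₉ ω²) ≤ (ω/μ)^n
  have hμn : 0 < (ω₀ + a) ^ n := pow_pos hμ n
  have key' : a * ℓ / (C₉ * ω ^ 2) ≤ q ^ n := by
    rw [hq, div_pow, div_le_div_iff₀ (by positivity) hμn]
    calc a * ℓ * (ω₀ + a) ^ n ≤ C₉ * ω ^ (n + 2) := key
      _ = ω ^ n * (C₉ * ω ^ 2) := by ring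
  exact absurd (key'.trans_lt hn) (lt_irrefl _)

/-- NO FADING MEMORY BELOW THE RATE `μ`: if `μ = ω₀ + a ≥ 1` then NO moduli table of the linear toy has fading memory at
ANY rate `ω < 1` (window admitting one bump). [folklore] -/
theorem not_fadingMemory_of_one_le {ℓ a ω₀ : ℝ} (hℓ : 0 < ℓ) (ha : 0 < a) (hω : 0 ≤ ω₀) (hμ : 1 ≤ ω₀ + a)
    {W : Set (ℕ → ℝ)} {Λ : ℕ → ℕ → ℝ} (hΛ : NormNE9 (linToy ℓ a ω₀) W Λ) {g : ℕ → ℝ} {i : ℕ} {δ : ℝ}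
    (hδ : 0 < δ) (hg : g ∈ W) (hg' : Function.update g i (g i + δ) ∈ W) {C₉ ω : ℝ} (hω1 : ω < 1) :
    ¬ FadingMemory C₉ ω Λ :=
  fun hF => (not_le.2 (hω1.trans_le hμ)) (rate_le_of_fadingMemory hℓ ha hω hΛ hδ hg hg' hF)

/-- **HEADLINE, NORM LEVEL — THE RATE `μ = ω₀ + a` OF `normNE9_of_stepTransfer` IS OPTIMAL ON THE `StepTransfer` CLASS.**
For `ℓ, a > 0`, `ω₀ ≥ 0` and a window admitting one bump there is a family of real activities, coupling-free at scale 0 and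
satisfying `StepTransfer V W ℓ a ω₀`, which HAS the module's moduli `geomMod ℓ μ` with `FadingMemory (ℓ/μ) μ`, and for
which EVERY moduli table with ANY fading-memory bound has rate `ω ≥ μ`.  So the smallness (W4) `μ < 1` of
`T4CouplingAnalyticity` is not an artefact of its proof: on the typed hypothesis class it is NECESSARY for fading memory.
[folklore] -/
theorem stepTransfer_rate_sharp {ℓ a ω₀ : ℝ} (hℓ : 0 < ℓ) (ha : 0 < a) (hω : 0 ≤ ω₀) {W : Set (ℕ → ℝ)}
    {g : ℕ → ℝ} {i : ℕ} {δ : ℝ} (hδ : 0 < δ) (hg : g ∈ W) (hg' : Function.update g i (g i + δ) ∈ W) :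
    ∃ V : ℕ → (ℕ → ℝ) → ℝ, (∀ h h' : ℕ → ℝ, V 0 h = V 0 h') ∧ StepTransfer V W ℓ a ω₀ ∧
      NormNE9 V W (geomMod ℓ (ω₀ + a)) ∧ FadingMemory (ℓ / (ω₀ + a)) (ω₀ + a) (geomMod ℓ (ω₀ + a)) ∧
        ∀ (Λ : ℕ → ℕ → ℝ) (C₉ ω : ℝ), NormNE9 V W Λ → FadingMemory C₉ ω Λ → ω₀ + a ≤ ω :=
  ⟨linToy ℓ a ω₀, fun _ _ => rfl, stepTransfer_linToy hℓ.le ha.le hω W,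
    normNE9_of_stepTransfer hℓ.le ha.le hω (fun _ _ _ _ => rfl) (stepTransfer_linToy hℓ.le ha.le hω W),
    fadingMemory_geomMod hℓ.le (by linarith), fun _ _ _ hΛ hF => rate_le_of_fadingMemory hℓ ha hω hΛ hδ hg hg' hF⟩

/-! ### The same at the level of the cell's shapes `T4OutputRate.NE9` / `FadingMemory` (toy carriers: one domain per scale) -/

/-- TOY CARRIERS: one localization domain per scale (`Dom = ℕ`, `scale = id`, tree length `0`), trivial backgrounds.
[folklore] -/
def natCarriers : Carriers where
  Dom := ℕ
  scale := id
  d := fun _ => 0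
  d_nonneg := fun _ => le_rfl
  BgA := Unit
  BgB := Unit
  gauge := fun _ _ => 0
  gauge_nonneg := fun _ _ => le_rfl
  transport := id

/-- The linear toy read as a one-step output functional on the toy carriers. [folklore] -/
def linFunc (ℓ a ω₀ : ℝ) : Functional natCarriers Unit := fun g _ j => linToy ℓ a ω₀ j g

/-- `NE9` of the toy functional is `NormNE9` of the toy activities (d = 0, scale = id). [folklore] -/
theorem normNE9_of_ne9_linFunc {ℓ a ω₀ κ : ℝ} {W : Set (ℕ → ℝ)} {Λ : ℕ → ℕ → ℝ}
    (h : NE9 (linFunc ℓ a ω₀) W κ Λ) : NormNE9 (linToy ℓ a ω₀) W Λ := by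
  intro j g hg g' hg'
  have := h g hg g' hg' () j
  simpa [linFunc, natCarriers] using this

/-- The positive side on the toy carriers (the module's theorem, instantiated): `StepTransfer` ⇒ `NE9 ∧ FadingMemory` with
rate `μ = ω₀ + a`. [folklore] -/
theorem ne9_linFunc {ℓ a ω₀ : ℝ} (hℓ : 0 ≤ ℓ) (ha : 0 ≤ a) (hω : 0 ≤ ω₀) (hμ : 0 < ω₀ + a) (W : Set (ℕ → ℝ))
    (κ : ℝ) :
    NE9 (linFunc ℓ a ω₀) W κ (geomMod ℓ (ω₀ + a)) ∧
      FadingMemory (ℓ / (ω₀ + a)) (ω₀ + a) (geomMod ℓ (ω₀ + a)) :=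
  ne9_and_fadingMemory_of_stepTransfer (C := natCarriers) (E := linFunc ℓ a ω₀) (V := linToy ℓ a ω₀)
    (fun b _ _ => b) (fun b b' _ X => by simp [natCarriers]) (fun _ _ _ _ => rfl) hℓ ha hω hμ (fun _ _ _ _ => rfl)
    (stepTransfer_linToy hℓ ha hω W)

/-- **HEADLINE AT THE SHAPE LEVEL**: any `T4OutputRate.NE9` moduli table of the toy functional with a
`T4OutputRate.FadingMemory C₉ ω` bound has `ω ≥ ω₀ + a`. [folklore] -/
theorem ne9_rate_sharp {ℓ a ω₀ : ℝ} (hℓ : 0 < ℓ) (ha : 0 < a) (hω : 0 ≤ ω₀) {W : Set (ℕ → ℝ)} {κ : ℝ}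
    {Λ : ℕ → ℕ → ℝ} (hΛ : NE9 (linFunc ℓ a ω₀) W κ Λ) {g : ℕ → ℝ} {i : ℕ} {δ : ℝ} (hδ : 0 < δ) (hg : g ∈ W)
    (hg' : Function.update g i (g i + δ) ∈ W) {C₉ ω : ℝ} (hF : FadingMemory C₉ ω Λ) : ω₀ + a ≤ ω :=
  rate_le_of_fadingMemory hℓ ha hω (normNE9_of_ne9_linFunc hΛ) hδ hg hg' hF

/-- **THE SMALLNESS (W4) IS NECESSARY ON THE CLASS — DICHOTOMY over a box `BoxWindow I` admitting one bump** (`s, s + δ ∈ I`,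
`δ > 0`; e.g. the t-box `[t₀, ∞[` or the g-window `]0, γ]`), for `ℓ, a > 0`, `ω₀ ≥ 0`:
(i) if `ω₀ + a < 1`, EVERY real activity family with coupling-free scale 0 and `StepTransfer V (BoxWindow I) ℓ a ω₀` has
`NE9 ∧ FadingMemory` at a rate `< 1` (the module's reduction); (ii) if `ω₀ + a ≥ 1`, SOME such family has, for EVERY moduli
table satisfying `NE9`, NO fading memory at ANY rate `< 1`.  The hypothesis class `StepTransfer` cannot deliver NE9-FADE
without (W4). [folklore] -/
theorem smallness_dichotomy {ℓ a ω₀ : ℝ} (hℓ : 0 < ℓ) (ha : 0 < a) (hω : 0 ≤ ω₀) {I : Set ℝ} {s δ : ℝ} (hδ : 0 < δ)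
    (hs : s ∈ I) (hs' : s + δ ∈ I) (κ : ℝ) :
    (ω₀ + a < 1 → ∀ V : ℕ → (ℕ → ℝ) → ℝ, (∀ g ∈ BoxWindow I, ∀ g' ∈ BoxWindow I, V 0 g = V 0 g') →
        StepTransfer V (BoxWindow I) ℓ a ω₀ →
          ∃ (Λ : ℕ → ℕ → ℝ) (C₉ ω : ℝ), ω < 1 ∧
            NE9 (C := natCarriers) (fun g (_ : Unit) j => V j g) (BoxWindow I) κ Λ ∧ FadingMemory C₉ ω Λ) ∧
      (1 ≤ ω₀ + a → ∃ V : ℕ → (ℕ → ℝ) → ℝ, (∀ g g' : ℕ → ℝ, V 0 g = V 0 g') ∧ StepTransfer V (BoxWindow I) ℓ a ω₀ ∧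
        ∀ (Λ : ℕ → ℕ → ℝ) (C₉ ω : ℝ), ω < 1 →
          NE9 (C := natCarriers) (fun g (_ : Unit) j => V j g) (BoxWindow I) κ Λ → ¬ FadingMemory C₉ ω Λ) := by
  refine ⟨fun hμ1 V h0 hstep => ?_, fun hμ1 => ?_⟩
  · have hμ : 0 < ω₀ + a := by linarith
    obtain ⟨hN, hF⟩ := ne9_and_fadingMemory_of_stepTransfer (C := natCarriers) (E := fun g (_ : Unit) j => V j g)
      (V := V) (fun b _ _ => b) (fun b b' _ X => by simp [natCarriers]) (fun _ _ _ _ => rfl) hℓ.le ha.le hω hμ h0 hstep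
    exact ⟨_, _, _, hμ1, hN, hF⟩
  · have hg : (fun _ : ℕ => s) ∈ BoxWindow I := fun _ => hs
    have hg' : Function.update (fun _ : ℕ => s) 0 ((fun _ : ℕ => s) 0 + δ) ∈ BoxWindow I :=
      update_mem_boxWindow hg 0 hs'
    exact ⟨linToy ℓ a ω₀, fun _ _ => rfl, stepTransfer_linToy hℓ.le ha.le hω _, fun Λ C₉ ω hω1 hΛ =>
      not_fadingMemory_of_one_le hℓ ha hω hμ1 (normNE9_of_ne9_linFunc hΛ) hδ hg hg' hω1⟩


/-! ## §2  The ANALYTIC DILATION TOY: a non-degenerate holomorphic step firing `ne9T_of_dilationStep` by name -/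

/-- PARAMETERS of the analytic dilation toy: the t-box floor `t₀ > 0`, the relative disc radius `0 < c < 1`, the amplitude
`α > 0` of the last-coupling channel `α·t₀/z` (a pole at the vertex `z = 0`, bounded holomorphic on every relative disc
`|z − s| ≤ c·s`, `s ≥ t₀`), the old-data coefficient `β ≥ 0`, the transport prefactor `0 ≤ θ ≤ 1`, the irrelevance rate
`ω₀ ≥ 0`, and the a-priori smallness `ω₀ + βθ < 1` (boundedness of the flow of activities). [folklore] -/
structure DilData where
  /-- floor of the t-box -/
  t₀ : ℝ
  /-- relative disc radius -/
  c : ℝ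
  /-- amplitude of the last-coupling channel -/
  α : ℝ
  /-- old-data coefficient -/
  β : ℝ
  /-- transport prefactor -/
  θ : ℝ
  /-- irrelevance rate -/
  ω₀ : ℝ
  ht₀ : 0 < t₀
  hc₀ : 0 < c
  hc₁ : c < 1
  hα : 0 < α
  hβ : 0 ≤ β
  hθ₀ : 0 ≤ θ
  hθ₁ : θ ≤ 1
  hω : 0 ≤ ω₀
  hsmall : ω₀ + β * θ < 1

namespace DilData

variable (P : DilData)

/-- THE STEP MAP `Φ(z, w) = α·t₀/z + β·w`: genuinely holomorphic and NON-affine in the last coupling `z` (pole at the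
vertex), affine in the transported old datum `w` (the located old-data channel (L6) is linear). [folklore] -/
def stepMap (z w : ℂ) : ℂ := ((P.α * P.t₀ : ℝ) : ℂ) / z + (P.β : ℂ) * w

/-- THE AGGREGATE `A j g = Σ_{m≤j} ω₀^{j−m}·V m g` of the toy, by recursion: `A 0 = 0`, `A (j+1) = ω₀·A j + Φ(g_j, θ·A j)`.
[folklore] -/
def agg : ℕ → (ℕ → ℝ) → ℂ
  | 0, _ => 0
  | j + 1, g => (P.ω₀ : ℂ) * agg j g + P.stepMap (g j : ℂ) ((P.θ : ℂ) * agg j g)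

/-- THE ACTIVITIES of the toy: `V 0 = 0` (coupling-free scale 0), `V (j+1) g = Φ(g_j, T j g)`. [folklore] -/
def act : ℕ → (ℕ → ℝ) → ℂ
  | 0, _ => 0
  | j + 1, g => P.stepMap (g j : ℂ) ((P.θ : ℂ) * P.agg j g)

/-- THE TRANSPORTED OLD DATA `T j g = θ·A j g = Σ_{m≤j} θ·ω₀^{j−m}·V m g`. [folklore] -/
def trans (j : ℕ) (g : ℕ → ℝ) : ℂ := (P.θ : ℂ) * P.agg j g

/-- Scale-0 value of the aggregate. [folklore] -/
@[simp] theorem agg_zero (g : ℕ → ℝ) : P.agg 0 g = 0 := rfl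

/-- Recursion of the aggregate in terms of the activities. [folklore] -/
theorem agg_succ (j : ℕ) (g : ℕ → ℝ) : P.agg (j + 1) g = (P.ω₀ : ℂ) * P.agg j g + P.act (j + 1) g := rfl

/-- Scale-0 activity vanishes (coupling-free). [folklore] -/
@[simp] theorem act_zero (g : ℕ → ℝ) : P.act 0 g = 0 := rfl

/-- Recursion of the activities through the step map and the transported data. [folklore] -/
theorem act_succ (j : ℕ) (g : ℕ → ℝ) : P.act (j + 1) g = P.stepMap (g j : ℂ) (P.trans j g) := rfl

/-- The aggregate is the ω₀-damped sum of the activities. [folklore] -/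
theorem agg_eq_sum (j : ℕ) (g : ℕ → ℝ) :
    P.agg j g = ∑ m ∈ Finset.range (j + 1), (P.ω₀ : ℂ) ^ (j - m) * P.act m g := by
  induction j with
  | zero => simp
  | succ j ih =>
    rw [Finset.sum_range_succ, Nat.sub_self, pow_zero, one_mul, agg_succ]
    have hsum : ∑ m ∈ Finset.range (j + 1), (P.ω₀ : ℂ) ^ (j + 1 - m) * P.act m g =
        (P.ω₀ : ℂ) * ∑ m ∈ Finset.range (j + 1), (P.ω₀ : ℂ) ^ (j - m) * P.act m g := by
      rw [Finset.mul_sum]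
      refine Finset.sum_congr rfl fun m hm => ?_
      rw [Finset.mem_range] at hm
      rw [show j + 1 - m = (j - m) + 1 by omega, pow_succ]
      ring
    rw [hsum, ← ih]

/-- (CONTR) for the toy: the transported old data are a sum of `ω₀^{j−m}`-contractions of the old activities (`θ ≤ 1`),
hence `‖T j g − T j g′‖ ≤ Σ_{m≤j} ω₀^{j−m}‖V m g − V m g′‖` (`contracts_of_sum`). [folklore] -/
theorem trans_contracts (W : Set (ℕ → ℝ)) :
    ∀ j, ∀ g ∈ W, ∀ g' ∈ W,
      ‖P.trans j g - P.trans j g'‖ ≤ ∑ m ∈ Finset.range (j + 1), P.ω₀ ^ (j - m) * ‖P.act m g - P.act m g'‖ := by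
  refine contracts_of_sum (V := P.act) (L := fun j m b => (P.θ : ℂ) * (P.ω₀ : ℂ) ^ (j - m) * b) ?_ ?_
  · intro j g _
    unfold trans
    rw [agg_eq_sum, Finset.mul_sum]
    refine Finset.sum_congr rfl fun m _ => ?_
    ring
  · intro j m b b'
    rw [← mul_sub, norm_mul, norm_mul, norm_pow, Complex.norm_real, Complex.norm_real, Real.norm_eq_abs,
      Real.norm_eq_abs, abs_of_nonneg P.hθ₀, abs_of_nonneg P.hω]
    calc P.θ * P.ω₀ ^ (j - m) * ‖b - b'‖ ≤ 1 * P.ω₀ ^ (j - m) * ‖b - b'‖ :=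
          mul_le_mul_of_nonneg_right (mul_le_mul_of_nonneg_right P.hθ₁ (pow_nonneg P.hω _)) (norm_nonneg _)
      _ = P.ω₀ ^ (j - m) * ‖b - b'‖ := by rw [one_mul]

/-- Norm bound of the step map away from the vertex: `‖z‖ ≥ r > 0 ⇒ ‖Φ(z, w)‖ ≤ α·t₀/r + β‖w‖`. [folklore] -/
theorem norm_stepMap_le {r : ℝ} (hr : 0 < r) {z : ℂ} (hz : r ≤ ‖z‖) (w : ℂ) :
    ‖P.stepMap z w‖ ≤ P.α * P.t₀ / r + P.β * ‖w‖ := by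
  unfold stepMap
  have hαt : 0 ≤ P.α * P.t₀ := (mul_pos P.hα P.ht₀).le
  calc ‖((P.α * P.t₀ : ℝ) : ℂ) / z + (P.β : ℂ) * w‖
      ≤ ‖((P.α * P.t₀ : ℝ) : ℂ) / z‖ + ‖(P.β : ℂ) * w‖ := norm_add_le _ _
    _ = P.α * P.t₀ / ‖z‖ + P.β * ‖w‖ := by
        rw [norm_div, norm_mul, Complex.norm_real, Complex.norm_real, Real.norm_eq_abs, Real.norm_eq_abs,
          abs_of_nonneg hαt, abs_of_nonneg P.hβ]
    _ ≤ P.α * P.t₀ / r + P.β * ‖w‖ := by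
        gcongr

/-- The a-priori denominator `1 − ω₀ − βθ > 0`. [folklore] -/
theorem den_pos : 0 < 1 - P.ω₀ - P.β * P.θ := by linarith [P.hsmall]

/-- THE A-PRIORI BOUND `B = α/(1 − ω₀ − βθ)` of the aggregate over the t-box. [folklore] -/
def B : ℝ := P.α / (1 - P.ω₀ - P.β * P.θ)

/-- The a-priori radius `B` is positive. [folklore] -/
theorem B_pos : 0 < P.B := div_pos P.hα P.den_pos

/-- The fixed-point identity of the a-priori bound: `ω₀·B + α + βθ·B = B`. [folklore] -/
theorem B_eq : P.ω₀ * P.B + P.α + P.β * P.θ * P.B = P.B := by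
  have h := P.den_pos
  unfold B
  field_simp
  ring

/-- **A-PRIORI BOUND**: over the t-box `t_i ≥ t₀` the aggregate stays in the ball of radius `B` at every scale (induction:
`‖A (j+1)‖ ≤ ω₀‖A j‖ + α·t₀/t_j + βθ‖A j‖ ≤ ω₀B + α + βθB = B`). [folklore] -/
theorem norm_agg_le {g : ℕ → ℝ} (hg : g ∈ BoxWindow (Set.Ici P.t₀)) : ∀ j, ‖P.agg j g‖ ≤ P.B := by
  intro j
  induction j with
  | zero => simpa using P.B_pos.le
  | succ j ih =>
    rw [agg_succ, act_succ]
    have hgj : P.t₀ ≤ g j := hg j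
    have hz : P.t₀ ≤ ‖((g j : ℝ) : ℂ)‖ := by
      rw [Complex.norm_real, Real.norm_eq_abs, abs_of_nonneg (P.ht₀.le.trans hgj)]
      exact hgj
    have hΦ := P.norm_stepMap_le P.ht₀ hz (P.trans j g)
    rw [mul_div_assoc, div_self P.ht₀.ne', mul_one] at hΦ
    have hT : ‖P.trans j g‖ ≤ P.θ * P.B := by
      unfold trans
      rw [norm_mul, Complex.norm_real, Real.norm_eq_abs, abs_of_nonneg P.hθ₀]
      exact mul_le_mul_of_nonneg_left ih P.hθ₀
    calc ‖(P.ω₀ : ℂ) * P.agg j g + P.stepMap (g j : ℂ) (P.trans j g)‖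
        ≤ ‖(P.ω₀ : ℂ) * P.agg j g‖ + ‖P.stepMap (g j : ℂ) (P.trans j g)‖ := norm_add_le _ _
      _ ≤ P.ω₀ * P.B + (P.α + P.β * (P.θ * P.B)) := by
          rw [norm_mul, Complex.norm_real, Real.norm_eq_abs, abs_of_nonneg P.hω]
          exact add_le_add (mul_le_mul_of_nonneg_left ih P.hω)
            (hΦ.trans (add_le_add le_rfl (mul_le_mul_of_nonneg_left hT P.hβ)))
      _ = P.B := by linear_combination P.B_eq

/-- THE BOUND `B_T = θ·B` of the transported old data over the t-box. [folklore] -/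
def BT : ℝ := P.θ * P.B

/-- The transported radius `B_T` is non-negative. [folklore] -/
theorem BT_nonneg : 0 ≤ P.BT := mul_nonneg P.hθ₀ P.B_pos.le

/-- Transported old data stay in the ball of radius `B_T`. [folklore] -/
theorem norm_trans_le {g : ℕ → ℝ} (hg : g ∈ BoxWindow (Set.Ici P.t₀)) (j : ℕ) : ‖P.trans j g‖ ≤ P.BT := by
  unfold trans BT
  rw [norm_mul, Complex.norm_real, Real.norm_eq_abs, abs_of_nonneg P.hθ₀]
  exact mul_le_mul_of_nonneg_left (P.norm_agg_le hg j) P.hθ₀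

/-- THE CAUCHY SUP BOUND `M₁ = α/(1 − c) + β·B_T` of (AN-LAST-dil) on the relative discs. [folklore] -/
def M₁ : ℝ := P.α / (1 - P.c) + P.β * P.BT

/-- The (AN-LAST) bound `M₁` is non-negative. [folklore] -/
theorem M₁_nonneg : 0 ≤ P.M₁ :=
  add_nonneg (div_nonneg P.hα.le (by linarith [P.hc₁])) (mul_nonneg P.hβ P.BT_nonneg)

/-- THE CAUCHY SUP BOUND `M₂(ϱ) = α + β·(B_T + ϱ)` of (AN-OLD) on the ϱ-balls about the admissible old data. [folklore] -/
def M₂ (ϱ : ℝ) : ℝ := P.α + P.β * (P.BT + ϱ)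

/-- The (AN-OLD) bound `M₂(ϱ)` is positive for `ϱ ≥ 0`. [folklore] -/
theorem M₂_pos {ϱ : ℝ} (hϱ : 0 ≤ ϱ) : 0 < P.M₂ ϱ :=
  add_pos_of_pos_of_nonneg P.hα (mul_nonneg P.hβ (add_nonneg P.BT_nonneg hϱ))

/-- THE DOMAIN of (AN-LAST-dil): the exterior `‖z‖ ≥ (1 − c)·t₀` of the vertex, which contains every relative disc
`|z − s| ≤ c·s`, `s ≥ t₀`. [folklore] -/
def lastDom : Set ℂ := {z | (1 - P.c) * P.t₀ ≤ ‖z‖}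

/-- The inner radius `(1 − c)·t₀` of `lastDom` is positive. [folklore] -/
theorem lastDom_rad_pos : 0 < (1 - P.c) * P.t₀ := mul_pos (by linarith [P.hc₁]) P.ht₀

/-- The relative discs `|z − s| ≤ c·s`, `s ≥ t₀`, lie in `lastDom`. [folklore] -/
theorem closedBall_subset_lastDom {s : ℝ} (hs : s ∈ Set.Ici P.t₀) : closedBall (s : ℂ) (P.c * s) ⊆ P.lastDom := by
  intro z hz
  rw [mem_closedBall, dist_eq_norm] at hz
  have hs0 : 0 ≤ s := P.ht₀.le.trans hs
  have h1 : ‖(s : ℂ)‖ - ‖z‖ ≤ ‖(s : ℂ) - z‖ := norm_sub_norm_le _ _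
  rw [norm_sub_rev, Complex.norm_real, Real.norm_eq_abs, abs_of_nonneg hs0] at h1
  show (1 - P.c) * P.t₀ ≤ ‖z‖
  have hc1 : 0 ≤ 1 - P.c := by linarith [P.hc₁]
  nlinarith [mul_le_mul_of_nonneg_left (show P.t₀ ≤ s from hs) hc1]

/-- (AN-LAST-dil), core: for any old datum `w` with `‖w‖ ≤ B_T`, `z ↦ Φ(z, w)` is holomorphic on `lastDom` (the pole
sits at the vertex, outside) and bounded there by `M₁`. [folklore] -/
theorem an_last_core {w : ℂ} (hw : ‖w‖ ≤ P.BT) :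
    DifferentiableOn ℂ (fun z => P.stepMap z w) P.lastDom ∧ ∀ z ∈ P.lastDom, ‖P.stepMap z w‖ ≤ P.M₁ := by
  refine ⟨?_, ?_⟩
  · intro z hz
    have hz0 : z ≠ 0 := by
      intro h
      have := P.lastDom_rad_pos
      rw [h] at hz
      simp only [lastDom, Set.mem_setOf_eq, norm_zero] at hz
      linarith
    unfold stepMap
    exact (((differentiableAt_const _).div differentiableAt_fun_id hz0).add_const _).differentiableWithinAt
  · intro z hz
    have h := P.norm_stepMap_le P.lastDom_rad_pos hz w
    refine h.trans ?_
    unfold M₁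
    rw [mul_comm (1 - P.c), ← div_div, mul_div_assoc, div_self P.ht₀.ne', mul_one]
    exact add_le_add le_rfl (mul_le_mul_of_nonneg_left hw P.hβ)

/-- (AN-LAST-dil) for the toy: `z ↦ Φ(z, T j g)` is holomorphic on `lastDom` and bounded there by `M₁`, and `lastDom`
contains the relative discs. [folklore] -/
theorem an_last {g : ℕ → ℝ} (hg : g ∈ BoxWindow (Set.Ici P.t₀)) (j : ℕ) :
    DifferentiableOn ℂ (fun z => P.stepMap z (P.trans j g)) P.lastDom ∧
      (∀ z ∈ P.lastDom, ‖P.stepMap z (P.trans j g)‖ ≤ P.M₁) ∧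
        ∀ s ∈ Set.Ici P.t₀, closedBall (s : ℂ) (P.c * s) ⊆ P.lastDom :=
  ⟨(P.an_last_core (P.norm_trans_le hg j)).1, (P.an_last_core (P.norm_trans_le hg j)).2,
    fun _ hs => P.closedBall_subset_lastDom hs⟩

/-- (AN-OLD), core: for real `s ≥ t₀`, `w ↦ Φ(s, w)` is entire and bounded by `M₂(ϱ)` on the ball `‖w‖ ≤ B_T + ϱ`.
[folklore] -/
theorem an_old_core (ϱ : ℝ) {s : ℝ} (hs : s ∈ Set.Ici P.t₀) :
    DifferentiableOn ℂ (P.stepMap (s : ℂ)) (closedBall (0 : ℂ) (P.BT + ϱ)) ∧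
      ∀ w ∈ closedBall (0 : ℂ) (P.BT + ϱ), ‖P.stepMap (s : ℂ) w‖ ≤ P.M₂ ϱ := by
  refine ⟨?_, ?_⟩
  · have : Differentiable ℂ (P.stepMap (s : ℂ)) := by
      show Differentiable ℂ fun w => ((P.α * P.t₀ : ℝ) : ℂ) / (s : ℂ) + (P.β : ℂ) * w
      exact (differentiable_fun_id.const_mul _).const_add _
    exact this.differentiableOn
  · intro w hw
    rw [mem_closedBall, dist_zero_right] at hw
    have hs0 : P.t₀ ≤ s := hs
    have hz : P.t₀ ≤ ‖(s : ℂ)‖ := by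
      rw [Complex.norm_real, Real.norm_eq_abs, abs_of_nonneg (P.ht₀.le.trans hs0)]
      exact hs0
    have h := P.norm_stepMap_le P.ht₀ hz w
    rw [mul_div_assoc, div_self P.ht₀.ne', mul_one] at h
    exact h.trans (add_le_add le_rfl (mul_le_mul_of_nonneg_left hw P.hβ))

/-- The `ϱ`-ball about a datum of norm `≤ B_T` lies in the ball `‖w‖ ≤ B_T + ϱ`. [folklore] -/
theorem closedBall_subset_of_norm_le {T : ℂ} (hT : ‖T‖ ≤ P.BT) (ϱ : ℝ) :
    closedBall T ϱ ⊆ closedBall (0 : ℂ) (P.BT + ϱ) := by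
  intro w hw
  rw [mem_closedBall] at hw ⊢
  calc dist w 0 ≤ dist w T + dist T 0 := dist_triangle _ _ _
    _ ≤ ϱ + P.BT := add_le_add hw (by rw [dist_zero_right]; exact hT)
    _ = P.BT + ϱ := add_comm _ _

/-- (AN-OLD) for the toy: for real `s ≥ t₀`, `w ↦ Φ(s, w)` is entire, bounded by `M₂(ϱ)` on the ball `‖w‖ ≤ B_T + ϱ`, which
contains every `ϱ`-ball about admissible old data. [folklore] -/
theorem an_old (ϱ : ℝ) (j : ℕ) {s : ℝ} (hs : s ∈ Set.Ici P.t₀) :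
    DifferentiableOn ℂ (P.stepMap (s : ℂ)) (closedBall (0 : ℂ) (P.BT + ϱ)) ∧
      (∀ w ∈ closedBall (0 : ℂ) (P.BT + ϱ), ‖P.stepMap (s : ℂ) w‖ ≤ P.M₂ ϱ) ∧
        ∀ g ∈ BoxWindow (Set.Ici P.t₀), closedBall (P.trans j g) ϱ ⊆ closedBall (0 : ℂ) (P.BT + ϱ) :=
  ⟨(P.an_old_core ϱ hs).1, (P.an_old_core ϱ hs).2, fun _ hg => P.closedBall_subset_of_norm_le (P.norm_trans_le hg j) ϱ⟩

/-- THE EVALUATION `ev b U X = e^{−κ d(X)}·Re b` and THE TOY FUNCTIONAL `E(g, U, X) = e^{−κ d(X)}·Re V (scale X) g` on ANY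
carriers (background-independent). [folklore] -/
def func (C : Carriers) (Bg : Type) (κ : ℝ) : Functional C Bg :=
  fun g _ X => Real.exp (-(κ * C.d X)) * (P.act (C.scale X) g).re

/-- The evaluation is `e^{−κd}`-Lipschitz from `ℂ` (|Re| ≤ ‖·‖). [folklore] -/
theorem ev_lipschitz (C : Carriers) (Bg : Type) (κ : ℝ) :
    ∀ (b b' : ℂ) (_ : Bg) (X : C.Dom),
      |Real.exp (-(κ * C.d X)) * b.re - Real.exp (-(κ * C.d X)) * b'.re| ≤ Real.exp (-(κ * C.d X)) * ‖b - b'‖ := by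
  intro b b' _ X
  rw [← mul_sub, abs_mul, abs_of_pos (Real.exp_pos _), ← Complex.sub_re]
  exact mul_le_mul_of_nonneg_left (Complex.abs_re_le_norm _) (Real.exp_pos _).le

/-- **THE WITNESS: `ne9T_of_dilationStep` FIRES ON THE TOY, BY NAME.**  Every one of its binders — (AN-LAST-dil) on the
relative discs with `M₁ = α/(1−c) + βB_T`, (AN-OLD) with `M₂ = α + β(B_T + ϱ)`, (CONTR), coupling-free scale 0, the
evaluation — is DISCHARGED for the holomorphic, non-affine step `Φ(z, w) = α·t₀/z + β·w`, and the conclusion is the cell's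
shape `T4OutputRate.NE9 ∧ T4OutputRate.FadingMemory` with moduli `geomMod ℓ μ`, `ℓ = 4M₁/(c·t₀)`, `μ = ω₀ + 4M₂/ϱ`, on any
carriers.  A [folklore] toy — NOT an instance of Bałaban's step (2.13); it shows the typed reduction of
`T4CouplingAnalyticity` is consistent and non-degenerate (below: every coupling of the history is felt), nothing more.
[folklore] -/
theorem ne9T_witness (C : Carriers) (Bg : Type) (κ : ℝ) {ϱ : ℝ} (hϱ : 0 < ϱ) :
    NE9 (P.func C Bg κ) (BoxWindow (Set.Ici P.t₀)) κ
        (geomMod (4 * P.M₁ / (P.c * P.t₀)) (P.ω₀ + 4 * P.M₂ ϱ / ϱ)) ∧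
      FadingMemory (4 * P.M₁ / (P.c * P.t₀) / (P.ω₀ + 4 * P.M₂ ϱ / ϱ)) (P.ω₀ + 4 * P.M₂ ϱ / ϱ)
        (geomMod (4 * P.M₁ / (P.c * P.t₀)) (P.ω₀ + 4 * P.M₂ ϱ / ϱ)) := by
  have hμ : 0 < P.ω₀ + 4 * P.M₂ ϱ / ϱ :=
    add_pos_of_nonneg_of_pos P.hω (div_pos (mul_pos (by norm_num) (P.M₂_pos hϱ.le)) hϱ)
  exact ne9T_of_dilationStep (E := P.func C Bg κ) (V := P.act) P.trans (fun _ => P.stepMap)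
    (fun b _ X => Real.exp (-(κ * C.d X)) * b.re) P.ht₀ P.hc₀ hϱ P.M₁_nonneg (P.M₂_pos hϱ.le).le P.hω hμ
    (ev_lipschitz C Bg κ) (fun g _ U X => rfl) (fun g _ g' _ => rfl) (fun j g _ => rfl)
    (fun j g hg => ⟨P.lastDom, P.an_last hg j⟩) (fun j s hs => ⟨closedBall (0 : ℂ) (P.BT + ϱ), P.an_old ϱ j hs⟩)
    (P.trans_contracts _)

/-! ### The real shadow of the toy and NON-DEGENERACY: every coupling of the history is felt at every later scale -/

/-- The step map on real arguments. [folklore] -/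
def stepMapR (s w : ℝ) : ℝ := P.α * P.t₀ / s + P.β * w

/-- Real shadow of the aggregate. [folklore] -/
def aggR : ℕ → (ℕ → ℝ) → ℝ
  | 0, _ => 0
  | j + 1, g => P.ω₀ * aggR j g + P.stepMapR (g j) (P.θ * aggR j g)

/-- Real shadow of the activities. [folklore] -/
def actR : ℕ → (ℕ → ℝ) → ℝ
  | 0, _ => 0
  | j + 1, g => P.stepMapR (g j) (P.θ * P.aggR j g)

/-- Recursion of the real activities. [folklore] -/
theorem actR_succ (j : ℕ) (g : ℕ → ℝ) : P.actR (j + 1) g = P.stepMapR (g j) (P.θ * P.aggR j g) := rfl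

/-- Recursion of the real aggregate in terms of the real activities. [folklore] -/
theorem aggR_succ (j : ℕ) (g : ℕ → ℝ) : P.aggR (j + 1) g = P.ω₀ * P.aggR j g + P.actR (j + 1) g := rfl

/-- The step map restricted to real arguments is the real step map. [folklore] -/
theorem stepMap_ofReal (s w : ℝ) : P.stepMap (s : ℂ) (w : ℂ) = (P.stepMapR s w : ℂ) := by
  unfold stepMap stepMapR
  push_cast
  ring

/-- On (real) histories the toy is real: `A j g = aggR j g`. [folklore] -/
theorem agg_ofReal (g : ℕ → ℝ) : ∀ j, P.agg j g = (P.aggR j g : ℂ)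
  | 0 => by simp [aggR]
  | j + 1 => by
    rw [agg_succ, act_succ, aggR_succ, actR_succ]
    unfold trans
    rw [agg_ofReal g j, ← Complex.ofReal_mul P.θ, stepMap_ofReal]
    push_cast
    ring

/-- On (real) histories the activities are real: `V j g = actR j g`. [folklore] -/
theorem act_ofReal (g : ℕ → ℝ) : ∀ j, P.act j g = (P.actR j g : ℂ)
  | 0 => by simp [actR]
  | j + 1 => by
    rw [act_succ, actR_succ]
    unfold trans
    rw [agg_ofReal, ← Complex.ofReal_mul P.θ, stepMap_ofReal]

/-- The toy functional in real terms: `E(g, U, X) = e^{−κd(X)}·actR (scale X) g`. [folklore] -/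
theorem func_eq (C : Carriers) (Bg : Type) (κ : ℝ) (g : ℕ → ℝ) (U : Bg) (X : C.Dom) :
    P.func C Bg κ g U X = Real.exp (-(κ * C.d X)) * P.actR (C.scale X) g := by
  unfold func
  rw [act_ofReal, Complex.ofReal_re]

/-- The real aggregate at scale `j ≤ i` does not see `g_i`. [folklore] -/
theorem aggR_update_of_le {j i : ℕ} (hji : j ≤ i) (g : ℕ → ℝ) (v : ℝ) :
    P.aggR j (Function.update g i v) = P.aggR j g := by
  induction j with
  | zero => rfl
  | succ j ih =>
    rw [aggR_succ, aggR_succ, actR_succ, actR_succ, ih (by omega), Function.update_of_ne (by omega)]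

/-- **EVERY COUPLING IS FELT, STRICTLY, AT EVERY LATER SCALE** (`β, θ > 0`): raising `g_i > 0` by `δ > 0` STRICTLY lowers the
newborn activity and the aggregate at every scale `≥ i + 1` (the last-coupling channel `α·t₀/s` is strictly decreasing and
the old-data channel propagates the decrease with the positive coefficients `βθ`, `ω₀`). [folklore] -/
theorem bump_lt (hβ : 0 < P.β) (hθ : 0 < P.θ) {g : ℕ → ℝ} {i : ℕ} (hgi : 0 < g i) {δ : ℝ} (hδ : 0 < δ) :
    ∀ n, P.actR (i + 1 + n) (Function.update g i (g i + δ)) < P.actR (i + 1 + n) g ∧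
      P.aggR (i + 1 + n) (Function.update g i (g i + δ)) < P.aggR (i + 1 + n) g
  | 0 => by
    have hαt : 0 < P.α * P.t₀ := mul_pos P.hα P.ht₀
    have hact : P.actR (i + 1) (Function.update g i (g i + δ)) < P.actR (i + 1) g := by
      rw [actR_succ, actR_succ, P.aggR_update_of_le le_rfl, Function.update_self]
      unfold stepMapR
      have : P.α * P.t₀ / (g i + δ) < P.α * P.t₀ / g i := div_lt_div_of_pos_left hαt hgi (by linarith)
      linarith
    refine ⟨by simpa using hact, ?_⟩
    rw [Nat.add_zero, aggR_succ, aggR_succ, P.aggR_update_of_le le_rfl]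
    linarith
  | n + 1 => by
    obtain ⟨_, hA⟩ := bump_lt hβ hθ hgi hδ n
    have hne : i + 1 + n ≠ i := by omega
    rw [show i + 1 + (n + 1) = (i + 1 + n) + 1 by omega]
    have hact : P.actR (i + 1 + n + 1) (Function.update g i (g i + δ)) < P.actR (i + 1 + n + 1) g := by
      rw [actR_succ, actR_succ, Function.update_of_ne hne]
      unfold stepMapR
      nlinarith [mul_lt_mul_of_pos_left hA (mul_pos hβ hθ)]
    refine ⟨hact, ?_⟩
    rw [aggR_succ, aggR_succ]
    exact add_lt_add_of_le_of_lt (mul_le_mul_of_nonneg_left hA.le P.hω) hact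

/-- At the functional level: on a domain `X` of scale `> i`, raising the coupling `g_i > 0` STRICTLY lowers `E(g, U, X)`.
[folklore] -/
theorem func_bump_lt (C : Carriers) (Bg : Type) (κ : ℝ) (hβ : 0 < P.β) (hθ : 0 < P.θ) {g : ℕ → ℝ} {i : ℕ}
    (hgi : 0 < g i) {δ : ℝ} (hδ : 0 < δ) (U : Bg) {X : C.Dom} (hX : i < C.scale X) :
    P.func C Bg κ (Function.update g i (g i + δ)) U X < P.func C Bg κ g U X := by
  obtain ⟨n, hn⟩ := Nat.exists_eq_add_of_lt hX
  rw [func_eq, func_eq, hn, show i + n + 1 = i + 1 + n by omega]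
  exact mul_lt_mul_of_pos_left (P.bump_lt hβ hθ hgi hδ n).1 (Real.exp_pos _)

/-- **NO NE9 MODULUS OF THE TOY CAN VANISH**: every `T4OutputRate.NE9` moduli table of the toy functional over the t-box has
`Λ (scale X) i > 0` for every domain `X` and every `i < scale X` (given one background) — the whole history enters.
[folklore] -/
theorem moduli_pos_of_ne9 (C : Carriers) (Bg : Type) (κ : ℝ) (hβ : 0 < P.β) (hθ : 0 < P.θ) {Λ : ℕ → ℕ → ℝ}
    (hΛ : NE9 (P.func C Bg κ) (BoxWindow (Set.Ici P.t₀)) κ Λ) (U : Bg) (X : C.Dom) {i : ℕ} (hX : i < C.scale X) :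
    0 < Λ (C.scale X) i := by
  have hg : (fun _ : ℕ => P.t₀) ∈ BoxWindow (Set.Ici P.t₀) := fun _ => Set.mem_Ici.2 le_rfl
  have hg' : Function.update (fun _ : ℕ => P.t₀) i ((fun _ : ℕ => P.t₀) i + 1) ∈ BoxWindow (Set.Ici P.t₀) :=
    update_mem_boxWindow hg i (Set.mem_Ici.2 (by simp))
  have h := hΛ _ hg' _ hg U X
  rw [sum_moduli_bump Λ hX, abs_one, mul_one] at h
  have hlt := P.func_bump_lt C Bg κ hβ hθ (g := fun _ : ℕ => P.t₀) (i := i) P.ht₀ one_pos U hX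
  have hpos : 0 < |P.func C Bg κ (Function.update (fun _ : ℕ => P.t₀) i ((fun _ : ℕ => P.t₀) i + 1)) U X -
      P.func C Bg κ (fun _ : ℕ => P.t₀) U X| := abs_pos.2 (sub_ne_zero.2 hlt.ne)
  by_contra hle
  push Not at hle
  have : Real.exp (-(κ * C.d X)) * Λ (C.scale X) i ≤ 0 := mul_nonpos_of_nonneg_of_nonpos (Real.exp_pos _).le hle
  linarith

/-! ### The toy also obeys the PRINTED shapes: prefix dependence (p. 256) and the decay bound (1.18) -/

/-- The aggregate at scale `j` depends only on the couplings `g 0, …, g (j−1)`. [folklore] -/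
theorem agg_congr {g g' : ℕ → ℝ} : ∀ j, (∀ i < j, g i = g' i) → P.agg j g = P.agg j g'
  | 0, _ => rfl
  | j + 1, h => by
    rw [agg_succ, agg_succ, act_succ, act_succ]
    unfold trans
    rw [agg_congr j fun i hi => h i (by omega), h j (by omega)]

/-- Activities at scale `j` depend only on the couplings `g 0, …, g (j−1)`. [folklore] -/
theorem act_congr {g g' : ℕ → ℝ} : ∀ j, (∀ i < j, g i = g' i) → P.act j g = P.act j g'
  | 0, _ => rfl
  | j + 1, h => by
    rw [act_succ, act_succ]
    unfold trans
    rw [P.agg_congr j fun i hi => h i (by omega), h j (by omega)]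

/-- The toy functional is PREFIX-DEPENDENT (`T4OutputRate.PrefixDependenceOn`) on every window. [folklore] -/
theorem func_prefix (C : Carriers) (Bg : Type) (κ : ℝ) (W : Set (ℕ → ℝ)) : PrefixDependenceOn (P.func C Bg κ) W := by
  intro g _ g' _ U X h
  unfold func
  rw [P.act_congr _ h]

/-- The activities are bounded by `B` over the t-box. [folklore] -/
theorem norm_act_le {g : ℕ → ℝ} (hg : g ∈ BoxWindow (Set.Ici P.t₀)) : ∀ j, ‖P.act j g‖ ≤ P.B
  | 0 => by simpa using P.B_pos.le
  | j + 1 => by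
    rw [act_succ]
    have hgj : P.t₀ ≤ g j := hg j
    have hz : P.t₀ ≤ ‖((g j : ℝ) : ℂ)‖ := by
      rw [Complex.norm_real, Real.norm_eq_abs, abs_of_nonneg (P.ht₀.le.trans hgj)]
      exact hgj
    have hΦ := P.norm_stepMap_le P.ht₀ hz (P.trans j g)
    rw [mul_div_assoc, div_self P.ht₀.ne', mul_one] at hΦ
    have hT := P.norm_trans_le hg j
    unfold BT at hT
    have hωB : 0 ≤ P.ω₀ * P.B := mul_nonneg P.hω P.B_pos.le
    calc ‖P.stepMap (g j : ℂ) (P.trans j g)‖ ≤ P.α + P.β * (P.θ * P.B) :=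
          hΦ.trans (add_le_add le_rfl (mul_le_mul_of_nonneg_left hT P.hβ))
      _ ≤ P.B := by linear_combination P.B_eq + hωB

/-- The toy functional obeys the DECAY BOUND shape (1.18) (`T4OutputRate.DecayBound`) with constant `B` over the t-box.
[folklore] -/
theorem func_decayBound (C : Carriers) (Bg : Type) (κ : ℝ) :
    DecayBound (P.func C Bg κ) (BoxWindow (Set.Ici P.t₀)) P.B κ := by
  intro g hg U X
  unfold func
  rw [abs_mul, abs_of_pos (Real.exp_pos _), mul_comm]
  exact mul_le_mul_of_nonneg_right ((Complex.abs_re_le_norm _).trans (P.norm_act_le hg _)) (Real.exp_pos _).le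

end DilData

/-! ### A numeric instance in the fading regime `μ < 1`, and the packaged witness -/

/-- THE INSTANCE `t₀ = 1, c = 1/2, α = β = 1/16, θ = 1, ω₀ = 1/4` (so `B = B_T = 1/11`, `M₁ = M₂(1) = 23/176`). [folklore] -/
def P₀ : DilData where
  t₀ := 1
  c := 1 / 2
  α := 1 / 16
  β := 1 / 16
  θ := 1
  ω₀ := 1 / 4
  ht₀ := one_pos
  hc₀ := by norm_num
  hc₁ := by norm_num
  hα := by norm_num
  hβ := by norm_num
  hθ₀ := by norm_num
  hθ₁ := le_rfl
  hω := by norm_num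
  hsmall := by norm_num

/-- Its rate at `ϱ = 1`: `μ = ω₀ + 4M₂(1) = 17/22`. [folklore] -/
theorem P₀_rate : P₀.ω₀ + 4 * P₀.M₂ 1 / 1 = 17 / 22 := by
  norm_num [DilData.M₂, DilData.BT, DilData.B, P₀]

/-- Its last-coupling modulus at `ϱ = 1`: `ℓ = 4M₁/(c·t₀) = 23/22`. [folklore] -/
theorem P₀_ell : 4 * P₀.M₁ / (P₀.c * P₀.t₀) = 23 / 22 := by
  norm_num [DilData.M₁, DilData.BT, DilData.B, P₀]

/-- The instance sits in the FADING regime `μ < 1`. [folklore] -/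
theorem P₀_small : P₀.ω₀ + 4 * P₀.M₂ 1 / 1 < 1 := by
  rw [P₀_rate]
  norm_num

/-- **THE PACKAGED WITNESS (answer to "zero witnesses")**: on ANY carriers there is a one-step output functional — produced by
a genuinely holomorphic, non-affine analytic step through `T4CouplingAnalyticity.ne9T_of_dilationStep` — which is
prefix-dependent, obeys the decay-bound shape (1.18), satisfies `T4OutputRate.NE9` over the t-box `t_i ≥ 1` with moduli
`geomMod (23/22) (17/22)` and `T4OutputRate.FadingMemory` at the rate `17/22 < 1`, and is NON-DEGENERATE: every NE9 moduli
table it admits is strictly positive at every slot `i < scale X` (one background given).  [folklore] toy; ASSERTS NOTHING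
about Bałaban's functionals; NOT summit progress. [folklore] -/
theorem witness_summary (C : Carriers) (Bg : Type) (κ : ℝ) :
    ∃ (E : Functional C Bg) (Λ : ℕ → ℕ → ℝ) (C₉ ω E₀ : ℝ),
      PrefixDependenceOn E (BoxWindow (Set.Ici P₀.t₀)) ∧ DecayBound E (BoxWindow (Set.Ici P₀.t₀)) E₀ κ ∧
        NE9 E (BoxWindow (Set.Ici P₀.t₀)) κ Λ ∧ FadingMemory C₉ ω Λ ∧ ω < 1 ∧
          ∀ Λ' : ℕ → ℕ → ℝ, NE9 E (BoxWindow (Set.Ici P₀.t₀)) κ Λ' →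
            Bg → ∀ X : C.Dom, ∀ i < C.scale X, 0 < Λ' (C.scale X) i :=
  ⟨P₀.func C Bg κ, _, _, _, P₀.B, P₀.func_prefix C Bg κ _, P₀.func_decayBound C Bg κ,
    (P₀.ne9T_witness C Bg κ one_pos).1, (P₀.ne9T_witness C Bg κ one_pos).2, P₀_small,
    fun _ h U X _ hi => P₀.moduli_pos_of_ne9 C Bg κ (by norm_num [P₀]) (by norm_num [P₀]) h U X hi⟩


/-! ## §3  The WEIGHTED VARIABLE-WINDOW TOY: `ne9T_of_dilationStepV` fires by name with an UNBOUNDED window -/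

/-- PARAMETERS of the window toy: those of §2 plus the weight base `0 ≤ ν ≤ 1` and an ARBITRARY window profile `N : ℕ → ℕ`
(unbounded allowed).  The newborn window-activity at step `j + 1` reads the OLDEST coupling of its window, `t_{j − N j}` —
the worst case for fading memory — through `ν^{N j}·Φ(t_{j−N j}, w)`: the WHOLE activity carries the weight `ν^{N j}`, the
typed form of [H-dil-N] WITH the printed weight (`T4CouplingAnalyticity` §14). [folklore] -/
structure WinData extends DilData where
  /-- weight base -/
  ν : ℝ
  /-- window profile -/
  N : ℕ → ℕ
  hν₀ : 0 ≤ ν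
  hν₁ : ν ≤ 1

namespace WinData

variable (Q : WinData)

/-- THE WINDOW STEP MAP `Φ_j(H, w) = ν^{N j}·Φ(H_{j − N j}, w)`. [folklore] -/
def stepMapV (j : ℕ) (H : ℕ → ℝ) (w : ℂ) : ℂ := ((Q.ν ^ Q.N j : ℝ) : ℂ) * Q.stepMap (H (j - Q.N j) : ℂ) w

/-- Aggregate of the window toy. [folklore] -/
def aggV : ℕ → (ℕ → ℝ) → ℂ
  | 0, _ => 0
  | j + 1, g => (Q.ω₀ : ℂ) * aggV j g + Q.stepMapV j g ((Q.θ : ℂ) * aggV j g)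

/-- Activities of the window toy (`V 0 = 0`). [folklore] -/
def actV : ℕ → (ℕ → ℝ) → ℂ
  | 0, _ => 0
  | j + 1, g => Q.stepMapV j g ((Q.θ : ℂ) * Q.aggV j g)

/-- Transported old data of the window toy. [folklore] -/
def transV (j : ℕ) (g : ℕ → ℝ) : ℂ := (Q.θ : ℂ) * Q.aggV j g

/-- Scale-0 value of the window aggregate. [folklore] -/
@[simp] theorem aggV_zero (g : ℕ → ℝ) : Q.aggV 0 g = 0 := rfl

/-- Recursion of the window aggregate in terms of the window activities. [folklore] -/
theorem aggV_succ (j : ℕ) (g : ℕ → ℝ) : Q.aggV (j + 1) g = (Q.ω₀ : ℂ) * Q.aggV j g + Q.actV (j + 1) g := rfl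

/-- Scale-0 window activity vanishes (coupling-free). [folklore] -/
@[simp] theorem actV_zero (g : ℕ → ℝ) : Q.actV 0 g = 0 := rfl

/-- Recursion of the window activities through the window step map. [folklore] -/
theorem actV_succ (j : ℕ) (g : ℕ → ℝ) : Q.actV (j + 1) g = Q.stepMapV j g (Q.transV j g) := rfl

/-- The weight `ν^{N j}` is non-negative. [folklore] -/
theorem nuPow_nonneg (j : ℕ) : 0 ≤ Q.ν ^ Q.N j := pow_nonneg Q.hν₀ _

/-- The weight `ν^{N j}` is at most `1`. [folklore] -/
theorem nuPow_le_one (j : ℕ) : Q.ν ^ Q.N j ≤ 1 := pow_le_one₀ Q.hν₀ Q.hν₁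

/-- The window step map depends on the history ONLY through the window slots `j − N j ≤ m ≤ j` (indeed only through the
oldest one). [folklore] -/
theorem win (j : ℕ) (w : ℂ) (h h' : ℕ → ℝ) (hh : ∀ m ∈ Finset.Icc (j - Q.N j) j, h m = h' m) :
    Q.stepMapV j h w = Q.stepMapV j h' w := by
  unfold stepMapV
  rw [hh (j - Q.N j) (Finset.mem_Icc.2 ⟨le_rfl, Nat.sub_le _ _⟩)]

/-- The window aggregate is the `ω₀`-geometric sum of the window activities. [folklore] -/
theorem aggV_eq_sum (j : ℕ) (g : ℕ → ℝ) :
    Q.aggV j g = ∑ m ∈ Finset.range (j + 1), (Q.ω₀ : ℂ) ^ (j - m) * Q.actV m g := by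
  induction j with
  | zero => simp
  | succ j ih =>
    rw [Finset.sum_range_succ, Nat.sub_self, pow_zero, one_mul, aggV_succ]
    have hsum : ∑ m ∈ Finset.range (j + 1), (Q.ω₀ : ℂ) ^ (j + 1 - m) * Q.actV m g =
        (Q.ω₀ : ℂ) * ∑ m ∈ Finset.range (j + 1), (Q.ω₀ : ℂ) ^ (j - m) * Q.actV m g := by
      rw [Finset.mul_sum]
      refine Finset.sum_congr rfl fun m hm => ?_
      rw [Finset.mem_range] at hm
      rw [show j + 1 - m = (j - m) + 1 by omega, pow_succ]
      ring
    rw [hsum, ← ih]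

/-- (CONTR) for the window toy. [folklore] -/
theorem transV_contracts (W : Set (ℕ → ℝ)) :
    ∀ j, ∀ g ∈ W, ∀ g' ∈ W,
      ‖Q.transV j g - Q.transV j g'‖ ≤ ∑ m ∈ Finset.range (j + 1), Q.ω₀ ^ (j - m) * ‖Q.actV m g - Q.actV m g'‖ := by
  refine contracts_of_sum (V := Q.actV) (L := fun j m b => (Q.θ : ℂ) * (Q.ω₀ : ℂ) ^ (j - m) * b) ?_ ?_
  · intro j g _
    unfold transV
    rw [aggV_eq_sum, Finset.mul_sum]
    refine Finset.sum_congr rfl fun m _ => ?_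
    ring
  · intro j m b b'
    rw [← mul_sub, norm_mul, norm_mul, norm_pow, Complex.norm_real, Complex.norm_real, Real.norm_eq_abs,
      Real.norm_eq_abs, abs_of_nonneg Q.hθ₀, abs_of_nonneg Q.hω]
    calc Q.θ * Q.ω₀ ^ (j - m) * ‖b - b'‖ ≤ 1 * Q.ω₀ ^ (j - m) * ‖b - b'‖ :=
          mul_le_mul_of_nonneg_right (mul_le_mul_of_nonneg_right Q.hθ₁ (pow_nonneg Q.hω _)) (norm_nonneg _)
      _ = Q.ω₀ ^ (j - m) * ‖b - b'‖ := by rw [one_mul]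

/-- Norm bound of the window step map at an admissible history: `‖Φ_j(H, w)‖ ≤ ν^{N j}·(α + β‖w‖)`. [folklore] -/
theorem norm_stepMapV_le (j : ℕ) {H : ℕ → ℝ} (hH : H ∈ BoxWindow (Set.Ici Q.t₀)) (w : ℂ) :
    ‖Q.stepMapV j H w‖ ≤ Q.ν ^ Q.N j * (Q.α + Q.β * ‖w‖) := by
  unfold stepMapV
  have hHm : Q.t₀ ≤ H (j - Q.N j) := hH _
  have hz : Q.t₀ ≤ ‖((H (j - Q.N j) : ℝ) : ℂ)‖ := by
    rw [Complex.norm_real, Real.norm_eq_abs, abs_of_nonneg (Q.ht₀.le.trans hHm)]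
    exact hHm
  have h := Q.norm_stepMap_le Q.ht₀ hz w
  rw [mul_div_assoc, div_self Q.ht₀.ne', mul_one] at h
  rw [norm_mul, Complex.norm_real, Real.norm_eq_abs, abs_of_nonneg (Q.nuPow_nonneg j)]
  exact mul_le_mul_of_nonneg_left h (Q.nuPow_nonneg j)

/-- A-priori bound of the window toy: the aggregate stays in the ball of radius `B` (the weight `ν^{N j} ≤ 1` only helps).
[folklore] -/
theorem norm_aggV_le {g : ℕ → ℝ} (hg : g ∈ BoxWindow (Set.Ici Q.t₀)) : ∀ j, ‖Q.aggV j g‖ ≤ Q.B := by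
  intro j
  induction j with
  | zero => simpa using Q.B_pos.le
  | succ j ih =>
    rw [aggV_succ, actV_succ]
    have hT : ‖Q.transV j g‖ ≤ Q.θ * Q.B := by
      unfold transV
      rw [norm_mul, Complex.norm_real, Real.norm_eq_abs, abs_of_nonneg Q.hθ₀]
      exact mul_le_mul_of_nonneg_left ih Q.hθ₀
    have hΦ := Q.norm_stepMapV_le j hg (Q.transV j g)
    have hin : Q.α + Q.β * ‖Q.transV j g‖ ≤ Q.α + Q.β * (Q.θ * Q.B) :=
      add_le_add le_rfl (mul_le_mul_of_nonneg_left hT Q.hβ)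
    calc ‖(Q.ω₀ : ℂ) * Q.aggV j g + Q.stepMapV j g (Q.transV j g)‖
        ≤ ‖(Q.ω₀ : ℂ) * Q.aggV j g‖ + ‖Q.stepMapV j g (Q.transV j g)‖ := norm_add_le _ _
      _ ≤ Q.ω₀ * Q.B + 1 * (Q.α + Q.β * (Q.θ * Q.B)) := by
          rw [norm_mul, Complex.norm_real, Real.norm_eq_abs, abs_of_nonneg Q.hω]
          exact add_le_add (mul_le_mul_of_nonneg_left ih Q.hω)
            (hΦ.trans (mul_le_mul (Q.nuPow_le_one j) hin
              (add_nonneg Q.hα.le (mul_nonneg Q.hβ (norm_nonneg _))) zero_le_one))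
      _ = Q.B := by linear_combination Q.B_eq

/-- Transported old data of the window toy stay in the ball of radius `B_T`. [folklore] -/
theorem norm_transV_le {g : ℕ → ℝ} (hg : g ∈ BoxWindow (Set.Ici Q.t₀)) (j : ℕ) : ‖Q.transV j g‖ ≤ Q.BT := by
  unfold transV DilData.BT
  rw [norm_mul, Complex.norm_real, Real.norm_eq_abs, abs_of_nonneg Q.hθ₀]
  exact mul_le_mul_of_nonneg_left (Q.norm_aggV_le hg j) Q.hθ₀

/-- `α ≤ α/(1 − c)` (`0 < 1 − c ≤ 1`). [folklore] -/
theorem alpha_le : Q.α ≤ Q.α / (1 - Q.c) := by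
  rw [le_div_iff₀ (by linarith [Q.hc₁])]
  nlinarith [Q.hα, Q.hc₀]

/-- (AN-WIN-dil) WITH THE WEIGHT, per window slot: for `m` the oldest slot the extension is `z ↦ ν^{N j}·Φ(z, T j g)` on
`lastDom` (bound `ν^{N j}·M₁`); for any other slot the dependence is constant (exact independence).  [folklore] -/
theorem an_lastV (j : ℕ) {g : ℕ → ℝ} (hg : g ∈ BoxWindow (Set.Ici Q.t₀)) {H : ℕ → ℝ}
    (hH : H ∈ BoxWindow (Set.Ici Q.t₀)) (m : ℕ) :
    ∃ (G : ℂ → ℂ) (D : Set ℂ), DifferentiableOn ℂ G D ∧ (∀ z ∈ D, ‖G z‖ ≤ Q.ν ^ Q.N j * Q.M₁) ∧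
      (∀ s ∈ Set.Ici Q.t₀, closedBall (s : ℂ) (Q.c * s) ⊆ D) ∧
        ∀ s ∈ Set.Ici Q.t₀, G s = Q.stepMapV j (Function.update H m s) (Q.transV j g) := by
  have hcore := Q.an_last_core (Q.norm_transV_le hg j)
  by_cases hm : m = j - Q.N j
  · subst hm
    refine ⟨fun z => ((Q.ν ^ Q.N j : ℝ) : ℂ) * Q.stepMap z (Q.transV j g), Q.lastDom, hcore.1.const_mul _, ?_,
      fun s hs => Q.closedBall_subset_lastDom hs, ?_⟩
    · intro z hz
      rw [norm_mul, Complex.norm_real, Real.norm_eq_abs, abs_of_nonneg (Q.nuPow_nonneg j)]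
      exact mul_le_mul_of_nonneg_left (hcore.2 z hz) (Q.nuPow_nonneg j)
    · intro s _
      simp only [stepMapV, Function.update_self]
  · refine ⟨fun _ => Q.stepMapV j H (Q.transV j g), Set.univ, differentiableOn_const _, ?_, fun _ _ => subset_univ _, ?_⟩
    · intro z _
      refine (Q.norm_stepMapV_le j hH _).trans (mul_le_mul_of_nonneg_left ?_ (Q.nuPow_nonneg j))
      unfold DilData.M₁
      exact add_le_add Q.alpha_le (mul_le_mul_of_nonneg_left (Q.norm_transV_le hg j) Q.hβ)
    · intro s _
      unfold stepMapV
      rw [Function.update_of_ne fun h => hm h.symm]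

/-- (AN-OLD) for the window toy: `w ↦ Φ_j(H, w)` entire, bounded by `M₂(ϱ)` on `‖w‖ ≤ B_T + ϱ` (weight `≤ 1`), which
contains the `ϱ`-balls about admissible old data. [folklore] -/
theorem an_oldV (ϱ : ℝ) (j : ℕ) {H : ℕ → ℝ} (hH : H ∈ BoxWindow (Set.Ici Q.t₀)) :
    DifferentiableOn ℂ (Q.stepMapV j H) (closedBall (0 : ℂ) (Q.BT + ϱ)) ∧
      (∀ w ∈ closedBall (0 : ℂ) (Q.BT + ϱ), ‖Q.stepMapV j H w‖ ≤ Q.M₂ ϱ) ∧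
        ∀ g ∈ BoxWindow (Set.Ici Q.t₀), closedBall (Q.transV j g) ϱ ⊆ closedBall (0 : ℂ) (Q.BT + ϱ) := by
  have hcore := Q.an_old_core ϱ (s := H (j - Q.N j)) (hH _)
  refine ⟨?_, ?_, fun g hg => Q.closedBall_subset_of_norm_le (Q.norm_transV_le hg j) ϱ⟩
  · show DifferentiableOn ℂ (fun w => ((Q.ν ^ Q.N j : ℝ) : ℂ) * Q.stepMap (H (j - Q.N j) : ℂ) w) _
    exact hcore.1.const_mul _
  · intro w hw
    unfold stepMapV
    rw [norm_mul, Complex.norm_real, Real.norm_eq_abs, abs_of_nonneg (Q.nuPow_nonneg j)]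
    calc Q.ν ^ Q.N j * ‖Q.stepMap (H (j - Q.N j) : ℂ) w‖ ≤ 1 * Q.M₂ ϱ :=
          mul_le_mul (Q.nuPow_le_one j) (hcore.2 w hw) (norm_nonneg _) zero_le_one
      _ = Q.M₂ ϱ := one_mul _

/-- The window-toy functional on any carriers. [folklore] -/
def funcV (C : Carriers) (Bg : Type) (κ : ℝ) : Functional C Bg :=
  fun g _ X => Real.exp (-(κ * C.d X)) * (Q.actV (C.scale X) g).re

/-- **THE WITNESS: `ne9T_of_dilationStepV` FIRES ON THE WINDOW TOY, BY NAME, WITH AN ARBITRARY (UNBOUNDED) WINDOW PROFILE.**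
All binders — (AN-WIN-dil) with the weighted bounds `M₁ j = ν^{N j}·M₁`, independence outside the window, (AN-OLD),
(CONTR), coupling-free scale 0, evaluation, `0 ≤ ν < μ ≤ 1`, and the ABSORPTION `4M₁ j/(c·t₀) ≤ σ₀·ν^{N j}` with
`σ₀ = 4M₁/(c·t₀)` (equality) — are discharged, and the conclusion is `NE9 ∧ FadingMemory` with the UNIFORM-IN-SCALE moduli
`srcMod (vwinSrc …) μ` and rate `μ = ω₀ + 4M₂/ϱ`.  [folklore] toy; ASSERTS NOTHING about Bałaban's R-operation; NOT summit
progress. [folklore] -/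
theorem ne9T_witnessV (C : Carriers) (Bg : Type) (κ : ℝ) {ϱ : ℝ} (hϱ : 0 < ϱ)
    (hνμ : Q.ν < Q.ω₀ + 4 * Q.M₂ ϱ / ϱ) (hμ1 : Q.ω₀ + 4 * Q.M₂ ϱ / ϱ ≤ 1) :
    NE9 (Q.funcV C Bg κ) (BoxWindow (Set.Ici Q.t₀)) κ
        (srcMod (vwinSrc (fun j => 4 * (Q.ν ^ Q.N j * Q.M₁) / (Q.c * Q.t₀)) Q.N) (Q.ω₀ + 4 * Q.M₂ ϱ / ϱ)) ∧
      FadingMemory (4 * Q.M₁ / (Q.c * Q.t₀) / (Q.ω₀ + 4 * Q.M₂ ϱ / ϱ - Q.ν)) (Q.ω₀ + 4 * Q.M₂ ϱ / ϱ)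
        (srcMod (vwinSrc (fun j => 4 * (Q.ν ^ Q.N j * Q.M₁) / (Q.c * Q.t₀)) Q.N) (Q.ω₀ + 4 * Q.M₂ ϱ / ϱ)) := by
  have hσ₀ : 0 ≤ 4 * Q.M₁ / (Q.c * Q.t₀) :=
    div_nonneg (mul_nonneg (by norm_num) Q.M₁_nonneg) (mul_pos Q.hc₀ Q.ht₀).le
  have habs : ∀ j, 4 * (Q.ν ^ Q.N j * Q.M₁) / (Q.c * Q.t₀) ≤ 4 * Q.M₁ / (Q.c * Q.t₀) * Q.ν ^ Q.N j :=
    fun j => le_of_eq (by ring)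
  exact ne9T_of_dilationStepV (E := Q.funcV C Bg κ) (V := Q.actV) Q.transV Q.stepMapV
    (fun b _ X => Real.exp (-(κ * C.d X)) * b.re) (M₁ := fun j => Q.ν ^ Q.N j * Q.M₁) Q.ht₀ Q.hc₀ hϱ
    (fun j => mul_nonneg (Q.nuPow_nonneg j) Q.M₁_nonneg) (Q.M₂_pos hϱ.le).le Q.hω hσ₀ Q.hν₀ hνμ hμ1 habs
    (DilData.ev_lipschitz C Bg κ) (fun g _ U X => rfl) (fun g _ g' _ => rfl) (fun j g _ => rfl) Q.win
    (fun j g hg H hH m _ => Q.an_lastV j hg hH m) (fun j H hH => ⟨_, Q.an_oldV ϱ j hH⟩) (Q.transV_contracts _)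

end WinData

/-- THE WINDOW INSTANCE: the §2 numbers with weight base `ν = 1/2` and the UNBOUNDED window profile `N j = ⌊j/2⌋` (the
newborn activity at step `j + 1` reads `t_{⌈j/2⌉}`). [folklore] -/
def Q₀ : WinData where
  toDilData := P₀
  ν := 1 / 2
  N := fun j => j / 2
  hν₀ := by norm_num
  hν₁ := by norm_num

/-- The window profile of the instance is unbounded. [folklore] -/
theorem Q₀_window_unbounded (K : ℕ) : ∃ j, K < Q₀.N j :=
  ⟨2 * K + 2, by show K < (2 * K + 2) / 2; omega⟩

/-- **The window instance FIRES**: `NE9 ∧ FadingMemory` at the rate `17/22` with `ν = 1/2 < 17/22 ≤ 1`, uniformly in the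
scale although the window is unbounded. [folklore] -/
theorem Q₀_fires (C : Carriers) (Bg : Type) (κ : ℝ) :
    NE9 (Q₀.funcV C Bg κ) (BoxWindow (Set.Ici Q₀.t₀)) κ
        (srcMod (vwinSrc (fun j => 4 * (Q₀.ν ^ Q₀.N j * Q₀.M₁) / (Q₀.c * Q₀.t₀)) Q₀.N) (Q₀.ω₀ + 4 * Q₀.M₂ 1 / 1)) ∧
      FadingMemory (4 * Q₀.M₁ / (Q₀.c * Q₀.t₀) / (Q₀.ω₀ + 4 * Q₀.M₂ 1 / 1 - Q₀.ν)) (Q₀.ω₀ + 4 * Q₀.M₂ 1 / 1)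
        (srcMod (vwinSrc (fun j => 4 * (Q₀.ν ^ Q₀.N j * Q₀.M₁) / (Q₀.c * Q₀.t₀)) Q₀.N) (Q₀.ω₀ + 4 * Q₀.M₂ 1 / 1)) := by
  have hrate : Q₀.ω₀ + 4 * Q₀.M₂ 1 / 1 = 17 / 22 := P₀_rate
  refine Q₀.ne9T_witnessV C Bg κ one_pos ?_ ?_
  · rw [hrate]
    show (1 : ℝ) / 2 < 17 / 22
    norm_num
  · rw [hrate]
    norm_num


/-! ## §4  THE WEIGHT IS NECESSARY: with an UNBOUNDED window the weight base `ν` is a FLOOR for the fading-memory rate of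
EVERY NE9-table of the window toy; UNWEIGHTED (`ν = 1`) unbounded windows admit NO uniform fading memory -/

namespace WinData

variable (Q : WinData)

/-- Real shadow of the window step map. [folklore] -/
def stepMapVR (j : ℕ) (H : ℕ → ℝ) (w : ℝ) : ℝ := Q.ν ^ Q.N j * Q.stepMapR (H (j - Q.N j)) w

/-- Real shadow of the window aggregate. [folklore] -/
def aggVR : ℕ → (ℕ → ℝ) → ℝ
  | 0, _ => 0
  | j + 1, g => Q.ω₀ * aggVR j g + Q.stepMapVR j g (Q.θ * aggVR j g)

/-- Real shadow of the window activities. [folklore] -/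
def actVR : ℕ → (ℕ → ℝ) → ℝ
  | 0, _ => 0
  | j + 1, g => Q.stepMapVR j g (Q.θ * Q.aggVR j g)

/-- Recursion of the real window activities. [folklore] -/
theorem actVR_succ (j : ℕ) (g : ℕ → ℝ) : Q.actVR (j + 1) g = Q.stepMapVR j g (Q.θ * Q.aggVR j g) := rfl

/-- Recursion of the real window aggregate. [folklore] -/
theorem aggVR_succ (j : ℕ) (g : ℕ → ℝ) : Q.aggVR (j + 1) g = Q.ω₀ * Q.aggVR j g + Q.actVR (j + 1) g := rfl

/-- The window step map on real arguments is the real window step map. [folklore] -/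
theorem stepMapV_ofReal (j : ℕ) (H : ℕ → ℝ) (w : ℝ) : Q.stepMapV j H (w : ℂ) = (Q.stepMapVR j H w : ℂ) := by
  unfold stepMapV stepMapVR
  rw [Q.stepMap_ofReal]
  push_cast
  ring

/-- On (real) histories the window aggregate is real. [folklore] -/
theorem aggV_ofReal (g : ℕ → ℝ) : ∀ j, Q.aggV j g = (Q.aggVR j g : ℂ)
  | 0 => by simp [aggVR]
  | j + 1 => by
    rw [aggV_succ, actV_succ, aggVR_succ, actVR_succ]
    unfold transV
    rw [aggV_ofReal g j, ← Complex.ofReal_mul Q.θ, stepMapV_ofReal]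
    push_cast
    ring

/-- On (real) histories the window activities are real. [folklore] -/
theorem actV_ofReal (g : ℕ → ℝ) : ∀ j, Q.actV j g = (Q.actVR j g : ℂ)
  | 0 => by simp [actVR]
  | j + 1 => by
    rw [actV_succ, actVR_succ]
    unfold transV
    rw [aggV_ofReal, ← Complex.ofReal_mul Q.θ, stepMapV_ofReal]

/-- The window-toy functional in real terms. [folklore] -/
theorem funcV_eq (C : Carriers) (Bg : Type) (κ : ℝ) (g : ℕ → ℝ) (U : Bg) (X : C.Dom) :
    Q.funcV C Bg κ g U X = Real.exp (-(κ * C.d X)) * Q.actVR (C.scale X) g := by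
  unfold funcV
  rw [actV_ofReal, Complex.ofReal_re]

/-- **THE WINDOW TOY IS ANTITONE IN THE HISTORY**: raising couplings (pointwise, positive histories) weakly LOWERS every
activity and every aggregate (the channel `α·t₀/s` decreases, all propagation coefficients `ν^{N j}, β, θ, ω₀` are `≥ 0`).
[folklore] -/
theorem antitone_hist {g g' : ℕ → ℝ} (hpos : ∀ m, 0 < g m) (hle : ∀ m, g m ≤ g' m) :
    ∀ j, Q.actVR j g' ≤ Q.actVR j g ∧ Q.aggVR j g' ≤ Q.aggVR j g
  | 0 => ⟨le_rfl, le_rfl⟩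
  | j + 1 => by
    obtain ⟨_, hA⟩ := antitone_hist hpos hle j
    have hαt : 0 < Q.α * Q.t₀ := mul_pos Q.hα Q.ht₀
    have hch : Q.α * Q.t₀ / g' (j - Q.N j) ≤ Q.α * Q.t₀ / g (j - Q.N j) :=
      div_le_div_of_nonneg_left hαt.le (hpos _) (hle _)
    have hact : Q.actVR (j + 1) g' ≤ Q.actVR (j + 1) g := by
      rw [actVR_succ, actVR_succ]
      unfold stepMapVR DilData.stepMapR
      refine mul_le_mul_of_nonneg_left ?_ (Q.nuPow_nonneg j)
      exact add_le_add hch (mul_le_mul_of_nonneg_left (mul_le_mul_of_nonneg_left hA Q.hθ₀) Q.hβ)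
    refine ⟨hact, ?_⟩
    rw [aggVR_succ, aggVR_succ]
    exact add_le_add (mul_le_mul_of_nonneg_left hA Q.hω) hact

/-- **THE OLDEST WINDOW SLOT IS FELT AT LEAST `ν^{N j}`-MUCH**: doubling the coupling `t_{j − N j} = t₀` of the constant history
lowers the newborn activity at step `j + 1` by at least `ν^{N j}·α/2`. [folklore] -/
theorem actVR_drop (j : ℕ) :
    Q.ν ^ Q.N j * (Q.α / 2) ≤
      Q.actVR (j + 1) (fun _ => Q.t₀) -
        Q.actVR (j + 1) (Function.update (fun _ => Q.t₀) (j - Q.N j) ((fun _ : ℕ => Q.t₀) (j - Q.N j) + Q.t₀)) := by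
  set g : ℕ → ℝ := fun _ => Q.t₀ with hg
  set g' : ℕ → ℝ := Function.update g (j - Q.N j) (g (j - Q.N j) + Q.t₀) with hg'
  have hpos : ∀ m, 0 < g m := fun _ => Q.ht₀
  have hle : ∀ m, g m ≤ g' m := by
    intro m
    by_cases hm : m = j - Q.N j
    · subst hm
      rw [hg', Function.update_self]
      linarith [Q.ht₀]
    · rw [hg', Function.update_of_ne hm]
  have hA := (Q.antitone_hist hpos hle j).2
  rw [actVR_succ, actVR_succ]
  unfold stepMapVR DilData.stepMapR
  rw [hg', Function.update_self]
  have hgi : g (j - Q.N j) = Q.t₀ := rfl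
  rw [hgi]
  have h1 : Q.α * Q.t₀ / Q.t₀ = Q.α := mul_div_cancel_right₀ _ Q.ht₀.ne'
  have h2 : Q.α * Q.t₀ / (Q.t₀ + Q.t₀) = Q.α / 2 := by
    rw [← two_mul, mul_comm 2 Q.t₀, ← div_div, mul_div_cancel_right₀ _ Q.ht₀.ne']
  rw [h1, h2, ← mul_sub]
  refine mul_le_mul_of_nonneg_left ?_ (Q.nuPow_nonneg j)
  have : Q.β * (Q.θ * Q.aggVR j g') ≤ Q.β * (Q.θ * Q.aggVR j g) :=
    mul_le_mul_of_nonneg_left (mul_le_mul_of_nonneg_left hA Q.hθ₀) Q.hβ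
  linarith

/-- On the toy carriers (one domain per scale, `d ≡ 0`) the window functional IS the real activity. [folklore] -/
theorem funcV_nat (κ : ℝ) (g : ℕ → ℝ) (j : ℕ) : Q.funcV natCarriers Unit κ g () j = Q.actVR j g := by
  rw [funcV_eq]
  simp [natCarriers]

/-- **MEMORY LOWER BOUND ON ANY NE9-TABLE of the window toy** (toy carriers: one domain per scale): the table must remember
the oldest window slot at least `ν^{N j}·α/(2t₀)`-much: `ν^{N j}·α/(2t₀) ≤ Λ (j+1) (j − N j)`. [folklore] -/
theorem weight_le_moduli (κ : ℝ) {Λ : ℕ → ℕ → ℝ}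
    (hΛ : NE9 (Q.funcV natCarriers Unit κ) (BoxWindow (Set.Ici Q.t₀)) κ Λ) (j : ℕ) :
    Q.ν ^ Q.N j * (Q.α / (2 * Q.t₀)) ≤ Λ (j + 1) (j - Q.N j) := by
  have hg : (fun _ : ℕ => Q.t₀) ∈ BoxWindow (Set.Ici Q.t₀) := fun _ => Set.mem_Ici.2 le_rfl
  have hg' : Function.update (fun _ : ℕ => Q.t₀) (j - Q.N j) ((fun _ : ℕ => Q.t₀) (j - Q.N j) + Q.t₀) ∈
      BoxWindow (Set.Ici Q.t₀) :=
    update_mem_boxWindow hg (j - Q.N j) (Set.mem_Ici.2 (by simp [Q.ht₀.le]))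
  have hlt : j - Q.N j < j + 1 := by omega
  have h : |Q.funcV natCarriers Unit κ (Function.update (fun _ : ℕ => Q.t₀) (j - Q.N j)
        ((fun _ : ℕ => Q.t₀) (j - Q.N j) + Q.t₀)) () (j + 1) - Q.funcV natCarriers Unit κ (fun _ : ℕ => Q.t₀) () (j + 1)|
      ≤ Real.exp (-(κ * 0)) * ∑ i' ∈ Finset.range (j + 1), Λ (j + 1) i' *
          |Function.update (fun _ : ℕ => Q.t₀) (j - Q.N j) ((fun _ : ℕ => Q.t₀) (j - Q.N j) + Q.t₀) i' -
            (fun _ : ℕ => Q.t₀) i'| :=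
    hΛ _ hg' _ hg () (j + 1)
  rw [Q.funcV_nat, Q.funcV_nat, sum_moduli_bump Λ hlt, abs_of_pos Q.ht₀, mul_zero, neg_zero, Real.exp_zero,
    one_mul, abs_sub_comm] at h
  have habs : Q.ν ^ Q.N j * (Q.α / 2) ≤ Λ (j + 1) (j - Q.N j) * Q.t₀ :=
    (Q.actVR_drop j).trans ((le_abs_self _).trans h)
  rw [show Q.α / (2 * Q.t₀) = Q.α / 2 / Q.t₀ by rw [div_div], ← mul_div_assoc]
  exact (div_le_iff₀ Q.ht₀).2 habs

/-- **THE WEIGHT BASE IS A FLOOR FOR THE RATE** (window profile unbounded along scales with `N j ≤ j`, `ν > 0`): EVERY NE9-table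
of the window toy with a fading-memory bound `Λ k i ≤ C₉ω^{k−i}`, `ω ≥ 0`, has `ν ≤ ω`.  With `ne9T_witnessV` (rate
`μ = ω₀ + 4M₂/ϱ` for `ν < μ ≤ 1`) the true rate is BRACKETED in `[ν, μ]`: the hypothesis `ν < μ` of `ne9T_of_dilationStepV` /
`fadingMemory_vwinSrc` cannot be weakened below `ν ≤ μ`. (The hypothesis `hω : 0 ≤ ω` is REDUNDANT here and in the
corollaries below that carry it — under `FadingMemory C₉ ω Λ` a negative `ω` forces `C₉·ω ≥ Λ (i+1) i ≥ 0` at lag one, hence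
`C₉ = 0` and `Λ ≡ 0` below the diagonal, contradicting `weight_le_moduli` —; it is kept in the signatures for by-name stability
of the v1.1 statements: cross-read C-pv11g15-9, item D-3.) [folklore] -/
theorem rate_floor (κ : ℝ) (hν : 0 < Q.ν) (hN : ∀ K, ∃ j, K ≤ Q.N j ∧ Q.N j ≤ j) {Λ : ℕ → ℕ → ℝ}
    (hΛ : NE9 (Q.funcV natCarriers Unit κ) (BoxWindow (Set.Ici Q.t₀)) κ Λ) {C₉ ω : ℝ} (hω : 0 ≤ ω)
    (hF : FadingMemory C₉ ω Λ) : Q.ν ≤ ω := by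
  by_contra hlt
  push Not at hlt
  have hC₉ : 0 ≤ C₉ := by
    have h0 := hF 0 0 le_rfl
    rw [Nat.sub_self, pow_zero, mul_one] at h0
    exact h0.1.trans h0.2
  have hr0 : 0 ≤ ω / Q.ν := div_nonneg hω hν.le
  have hr1 : ω / Q.ν < 1 := (div_lt_one hν).2 hlt
  have hω1 : ω ≤ 1 := hlt.le.trans Q.hν₁
  have hc : 0 < Q.α / (2 * Q.t₀) := div_pos Q.hα (by linarith [Q.ht₀])
  have hC1 : 0 < C₉ + 1 := by linarith
  obtain ⟨n, hn⟩ := exists_pow_lt_of_lt_one (div_pos hc hC1) hr1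
  obtain ⟨j, hj1, hj2⟩ := hN n
  have hlow := Q.weight_le_moduli κ hΛ j
  have hup := (hF (j + 1) (j - Q.N j) (by omega)).2
  rw [show j + 1 - (j - Q.N j) = Q.N j + 1 by omega] at hup
  have hup' : Λ (j + 1) (j - Q.N j) ≤ C₉ * ω ^ Q.N j :=
    hup.trans (mul_le_mul_of_nonneg_left (pow_le_pow_of_le_one hω hω1 (Nat.le_succ _)) hC₉)
  have hνN : 0 < Q.ν ^ Q.N j := pow_pos hν _
  have hkey : Q.α / (2 * Q.t₀) ≤ C₉ * (ω / Q.ν) ^ Q.N j := by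
    rw [div_pow, ← mul_div_assoc, le_div_iff₀ hνN]
    linarith [hlow, hup']
  have hmono : (ω / Q.ν) ^ Q.N j ≤ (ω / Q.ν) ^ n := pow_le_pow_of_le_one hr0 hr1.le hj1
  have h1 : C₉ * (ω / Q.ν) ^ Q.N j ≤ (C₉ + 1) * (ω / Q.ν) ^ n :=
    (mul_le_mul_of_nonneg_left hmono hC₉).trans (by nlinarith [pow_nonneg hr0 n])
  have h2 : (C₉ + 1) * (ω / Q.ν) ^ n < Q.α / (2 * Q.t₀) := by
    rw [mul_comm]
    exact (lt_div_iff₀ hC1).1 hn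
  linarith

/-- **UNWEIGHTED UNBOUNDED WINDOWS HAVE NO UNIFORM FADING MEMORY**: at `ν = 1` NO NE9-table of the window toy satisfies
`FadingMemory C₉ ω` for ANY `C₉` and ANY rate `0 ≤ ω < 1` — the kernel form of the reason gen 6 withdrew «(WIN) N fixed»
(record §13.2: the fixed-window constant `ℓ(N+1)/μ^{N+1}` is not uniform in the scale) and of why [H-dil-N] must carry the
printed WEIGHT (§14 of `T4CouplingAnalyticity`). [folklore] -/
theorem not_fadingMemory_unweighted (κ : ℝ) (hν1 : Q.ν = 1) (hN : ∀ K, ∃ j, K ≤ Q.N j ∧ Q.N j ≤ j)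
    {Λ : ℕ → ℕ → ℝ} (hΛ : NE9 (Q.funcV natCarriers Unit κ) (BoxWindow (Set.Ici Q.t₀)) κ Λ) {C₉ ω : ℝ}
    (hω0 : 0 ≤ ω) (hω1 : ω < 1) : ¬ FadingMemory C₉ ω Λ := by
  intro hF
  have h := Q.rate_floor κ (by rw [hν1]; exact one_pos) hN hΛ hω0 hF
  rw [hν1] at h
  exact (not_le.2 hω1) h

/-- **THE RATE BRACKET** `[ν, μ]` on the window class: (i) the module's reduction gives a table at rate `μ = ω₀ + 4M₂(ϱ)/ϱ`
whenever `ν < μ ≤ 1`; (ii) no table has a rate below `ν`. [folklore] -/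
theorem rate_bracket (κ : ℝ) (hν : 0 < Q.ν) (hN : ∀ K, ∃ j, K ≤ Q.N j ∧ Q.N j ≤ j) {ϱ : ℝ} (hϱ : 0 < ϱ)
    (hνμ : Q.ν < Q.ω₀ + 4 * Q.M₂ ϱ / ϱ) (hμ1 : Q.ω₀ + 4 * Q.M₂ ϱ / ϱ ≤ 1) :
    (∃ (Λ : ℕ → ℕ → ℝ) (C₉ : ℝ), NE9 (Q.funcV natCarriers Unit κ) (BoxWindow (Set.Ici Q.t₀)) κ Λ ∧
        FadingMemory C₉ (Q.ω₀ + 4 * Q.M₂ ϱ / ϱ) Λ) ∧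
      ∀ (Λ : ℕ → ℕ → ℝ) (C₉ ω : ℝ), 0 ≤ ω → NE9 (Q.funcV natCarriers Unit κ) (BoxWindow (Set.Ici Q.t₀)) κ Λ →
        FadingMemory C₉ ω Λ → Q.ν ≤ ω :=
  ⟨let h := Q.ne9T_witnessV natCarriers Unit κ hϱ hνμ hμ1; ⟨_, _, h.1, h.2⟩,
    fun _ _ _ hω hΛ hF => Q.rate_floor κ hν hN hΛ hω hF⟩

end WinData

/-- For the window instance `Q₀` (`ν = 1/2`, `N j = ⌊j/2⌋`) every NE9-table has rate `≥ 1/2`, while `Q₀_fires` supplies one at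
rate `17/22`: the true fading-memory rate of the instance lies in `[1/2, 17/22]`. [folklore] -/
theorem Q₀_rate_floor (κ : ℝ) {Λ : ℕ → ℕ → ℝ}
    (hΛ : NE9 (Q₀.funcV natCarriers Unit κ) (BoxWindow (Set.Ici Q₀.t₀)) κ Λ) {C₉ ω : ℝ} (hω : 0 ≤ ω)
    (hF : FadingMemory C₉ ω Λ) : (1 : ℝ) / 2 ≤ ω :=
  Q₀.rate_floor κ (by show (0 : ℝ) < 1 / 2; norm_num) (fun K => ⟨2 * K, by show K ≤ 2 * K / 2 ∧ 2 * K / 2 ≤ 2 * K; omega⟩)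
    hΛ hω hF

/-- THE UNWEIGHTED INSTANCE: the §2 numbers with `ν = 1` and the unbounded profile `N j = ⌊j/2⌋`. [folklore] -/
def Q₁ : WinData where
  toDilData := P₀
  ν := 1
  N := fun j => j / 2
  hν₀ := by norm_num
  hν₁ := le_rfl

/-- **The unweighted instance has NO uniform fading memory**: for every `κ`, NO table `Λ` with `NE9 (Q₁.funcV …) … κ Λ` satisfies
`FadingMemory C₉ ω Λ` for any `C₉` and any `0 ≤ ω < 1` — although each of its activities is a bounded holomorphic function
of the couplings on the dilation discs (the SAME analytic data as `Q₀`, minus the weight). [folklore] -/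
theorem Q₁_no_fading (κ : ℝ) {Λ : ℕ → ℕ → ℝ}
    (hΛ : NE9 (Q₁.funcV natCarriers Unit κ) (BoxWindow (Set.Ici Q₁.t₀)) κ Λ) {C₉ ω : ℝ} (hω0 : 0 ≤ ω)
    (hω1 : ω < 1) : ¬ FadingMemory C₉ ω Λ :=
  Q₁.not_fadingMemory_unweighted κ rfl (fun K => ⟨2 * K, by show K ≤ 2 * K / 2 ∧ 2 * K / 2 ≤ 2 * K; omega⟩) hΛ hω0 hω1


end Literature.MathematicalPhysics.QuantumFieldTheory.Balaban1983to89.T4CouplingAnalyticityWitness
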